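import Literature.AlgebraicGeometry.Motives.HodgeThetaSubalgebraSymplecticBlocks
import HarnessLib

/-!
# Rational Lie algebras containing the Hodge operator on a weight-one Hodge structure cut into FOUR-dimensional real,
# mutually orthogonal blocks that may be LINKED by Hodge endomorphisms: `𝔤_ℂ = ⊕_{classes} 𝔰𝔭₄` glued along the links,
# `𝔤_ℂ = 𝔰𝔭_E(V, ψ)_ℂ`, `𝔤 = Lie Hg`, and Theorem L (Moonen–Zarhin 1995, simple abelian fourfolds of Type II
# «`Hg = Sp_D(V, φ)`»; Murty 1984 Thm. 3.1; Hazama 1983 §3 «the i-th component acts on `V_i ⊕ ⋯ ⊕ V_i` diagonally»)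

Family `hodge`, layer `Literature/AlgebraicGeometry/Motives` (abstract polarizable `ℚ`-Hodge structures; no geometry).
THEOREMS ONLY (no definition, no named fact; D-0026); UNCONDITIONAL linear algebra; no step towards a summit statement.
Written for the cell `pub-hodge-ring2` (HONEST FRAMING: research route conditional on HC_CM; not a corollary;
Q11.4-sentence-2 already refuted in dim ≥ 3), Literature lane gen 71, programme R48 «the TYPE II row of Moonen–Zarhin 1995»
(simple abelian fourfolds whose endomorphism algebra is an indefinite quaternion algebra over `ℚ`; in general: type II with
`H¹` free of rank TWO over the quaternion algebra) — THE LIE STEP for an ARBITRARY admissible algebra.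

THE TREE ALREADY HAS the two neighbouring situations: `HodgeThetaSubalgebraSymplecticBlocks` (gen 70, `SpBlocksTheta.*`:
four-dimensional real blocks which are the joint EIGENSPACES of a commutative `E = End_Hdg(V)` — no links, `𝔤_ℂ = ⊕_i 𝔰𝔭(T_i)`;
Moonen–Zarhin Type I(2)) and `HodgeThetaSubalgebraGluedRealBlocks` (`GluedBlocks.*`: TWO-dimensional real blocks linked by
`E ⊗ ℂ`, `𝔤_ℂ = ⊕_{classes} 𝔰𝔩₂`; type II minimal, Moonen–Zarhin (2.2) Type 2(1)). THIS FILE is the common refinement needed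
for type II of the next rank: FOUR-dimensional real blocks LINKED by `E ⊗ ℂ`.

SETTING. `H` an effective polarized `ℚ`-Hodge structure of weight `1` on a finite-dimensional `V`, `ψ` a polarization, `Θ` a Hodge
operator (`= 2p - 1` on `V^{p,1-p}`), `E = End_Hdg(V)`, `E_ℂ = span_ℂ {a ⊗ 1 : a ∈ E}`, and an internal decomposition
`V_ℂ = ⊕_{p ∈ ι} T_p` into FOUR-dimensional blocks which are
* REAL: `conj T_p = T_p` (`hconj`);
* mutually `ψ_ℂ`-ORTHOGONAL (`horth`; e.g. the images of `ψ`-self-adjoint idempotents of `E ⊗ ℝ`);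
* preserved by every `ℂ`-linear operator commuting with `E_ℂ` (`hTE`; e.g. images of idempotents in `E ⊗ ℝ`);
* SEPARATED BY `E` ONLY THROUGH SCALARS: an element of `E_ℂ` preserving every block is a scalar on each block (`hscal`);
* grouped in CLASSES by a map `cls : ι → ι` such that `E_ℂ` carries each block into the sum of the blocks of its class
  (`hsep`) — and, for §5, every block `T_p` is the image of the block `T_{cls p}` under an element of `E_ℂ` with an inverse
  in `E_ℂ` (`hlink`), `cls ∘ cls = cls` (`hcls`).
An ADMISSIBLE algebra is a bracket-closed `ℚ`-subspace `𝔤 ⊆ End_ℚ(V)` of `ψ`-skew operators commuting with `E` with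
`Θ ∈ 𝔤_ℂ` (`Lie Hg`, or the annihilator `𝔞(q)` of a rational Hodge tensor, `HodgeThetaAnnihilatorLieAlgebra.annLie`).

THE TYPE II INSTANCE (sequel `HodgeTheory/TypeIIRankTwoPowersLieInvariance`): `D = End⁰(A)` a totally indefinite quaternion
algebra over a totally real `F`, `Φ : ℝ ⊗ D ≃ ∏_{places} M₂(ℝ)` a real splitting carrying the Rosati involution to
transposition, `T_{(v,j)} = u(v)_{jj} · V_ℂ` the images of the real matrix units (`dim A = 4[F:ℚ]` makes them
four-dimensional), `cls (v,j) = (v,0)`, links `u(v)_{j0}`. Moonen–Zarhin 1995 (Duke 77), simple fourfolds of Type II: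
«`Hg(X) = Sp_D(V,φ)`» = `U_{D^opp}`, no exceptional Hodge classes (their Thm., quoted by Gordon, Thm. 5.1: exceptional classes
occur iff `End⁰X ⊇ k` imaginary quadratic stable under all Rosati involutions with `Lie X` free over `k ⊗ ℂ` — never for
type II); V. K. Murty 1984 Thm. 3.1 («`Hg = L` and no type III ⟹ `B•(Xⁿ) = D•(Xⁿ)`»).

RESULTS (all for an arbitrary admissible `𝔤`; `hbr`, `hcomm`, `hskew`, `hΘ𝔤 : Θ ∈ spanC 𝔤`).
* §0 `GluedSp.apply_mem_block` (`𝔤_ℂ` preserves the blocks), `GluedSp.eq_zero_of_forall_block` (`ψ_ℂ|_{T_p}` non-degenerate).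
* §1 `GluedSp.eq_bot_or_eq_block_of_stable` — IRREDUCIBILITY of every block under `𝔤` (the projector onto a stable `U ⊆ T_p`
  along `U†` commutes with `𝔤`, lies in `E_ℂ` by descent, preserves all blocks by reality and orthogonality, hence is a scalar
  on `T_p` by `hscal`; Zarhin 1983 §2).
* §2 `GluedSp.exists_blockData`, **`GluedSp.exists_mem_spanC_restrict_eq`** — `𝔤_ℂ` restricts ONTO `𝔰𝔭(T_p, ψ_ℂ|_{T_p})` on
  every block (the core theorem `SymplecticTheta.core_of_irreducible`, dim 4).
* §3 `GluedSp.restrict_ideal_dichotomy`, `GluedSp.apply_eq_zero_of_forall_commute`, **`GluedSp.isSemisimple`**.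
* §4 `GluedSp.exists_complement_ideal`, `GluedSp.eq_zero_of_equivariant` (no non-zero `𝔤`-equivariant map between blocks of
  DIFFERENT classes: commutant descent + `hsep`), **`GluedSp.exists_mem_spanC_supported`** — THE GOURSAT STEP WITH CLASSES:
  every `ψ_ℂ|_{T_p}`-skew `g` on `T_p` is the restriction of some `Y ∈ 𝔤_ℂ` vanishing on all blocks of the OTHER classes
  (`SymplecticWitness.exists_equivariant_ne_zero`: the standard representation is the only length-one representation of `𝔰𝔭`).
* §5 (with links) **`GluedSp.mem_spanC_of_commute_of_skew`** — every `ψ_ℂ`-skew operator commuting with `E_ℂ` lies in `𝔤_ℂ`: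
  `𝔤_ℂ = 𝔰𝔭_E(V, ψ)_ℂ = ⊕_{classes} 𝔰𝔭₄` glued along the links («`Hg(X) = Sp_D(V, φ)`», Moonen–Zarhin; «`V_ℂ = W ⊗ ℂ²`, the
  standard representation twice», Abdulali §2.4 / Milne §2 for type II); `GluedSp.mem_spanC_iff_commute_and_skew`,
  `GluedSp.mem_iff_commute_and_skew`, **`GluedSp.eq_hodgeLie`** (`𝔤 = Lie Hg(H)`: Deligne's minimality in Lie form),
  `GluedSp.mem_hodgeLieC_iff_commute_and_skew`; and THEOREM L **`GluedSp.wordDerAt_eq_zero_of_commute_of_skew`** — a RATIONAL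
  coefficient tensor killed slice by slice by the matrix of `Θ` is killed by the matrix of every `ψ_ℂ`-skew operator commuting
  with `E_ℂ` (the Lie input of «`B•(Xⁿ) = D•(Xⁿ)` for type II of quaternion rank two», whose geometric half is the sequel).

## References

* [MoonenZarhin1995Duke] B. Moonen, Yu. G. Zarhin, *Hodge classes and Tate classes on simple abelian fourfolds*, Duke Math.
  J. 77 (1995) 553–581, the Type II row: «`Hg(X) = Sp_D(V, φ)`», `B•(X) = D•(X)`. [cite: MoonenZarhin1995Duke, Type II]
* [Gordon1999HodgeAVSurvey] B. B. Gordon, *A survey of the Hodge conjecture for abelian varieties* (held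
  `paper:arxiv-alg-geom_9709030`), Thm. 5.1 (= [B.75] Thm. 2.4, p0016 L48–53), §7 Thm. 7.5. [cite: Gordon1999HodgeAVSurvey, Thm. 5.1]
* [MoonenZarhin1999LowDim] B. Moonen, Yu. G. Zarhin, Math. Ann. 315 (1999) 711–733 (held `paper:arxiv-math_9901113`),
  §2 (2.2) Type 2(1), (2.5), §3 (3.1), Lemma (3.4). [cite: MoonenZarhin1999LowDim, §2 (2.5) and §3 (3.1)]
* [Murty1984] V. K. Murty, *Exceptional Hodge classes on certain abelian varieties*, Math. Ann. 268 (1984), Thm. 3.1, §3.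
  [cite: Murty1984, Thm. 3.1 and §3]
* [Hazama1983] F. Hazama, Tôhoku Math. J. 35 (1983) 303–308, §3 pp. 305–306 (blocks, Goursat over the places, diagonal
  action on isomorphic blocks). [cite: Hazama1983, §3 (pp. 305–306)]
* [Abdulali2016TateTwists] S. Abdulali, in LMS LN 427 (2016), §2.4 (type II: `V_α` is two copies of the standard
  representation of a symplectic group). [cite: Abdulali2016TateTwists, §2.4]
* [Deligne1982HodgeCycles] P. Deligne, LNM 900 (1982), I §3 Prop. 3.4 (minimality, descent), Prop. 3.6 (reductivity).
  [cite: Deligne1982HodgeCycles, I §3 Prop. 3.4]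
* [Zarhin1983HodgeGroupsK3] Yu. G. Zarhin, J. reine angew. Math. 341 (1983), §2. [cite: Zarhin1983HodgeGroupsK3, §2]
* [Humphreys1972] J. E. Humphreys, GTM 9, §5.2, §19.1. [cite: Humphreys1972, §5.2]
* [GoodmanWallachGTM255] R. Goodman, N. Wallach, GTM 255, §2.1.2 (Siegel form of `𝔰𝔭`). [cite: GoodmanWallachGTM255, §2.1.2]
-/

noncomputable section

open scoped TensorProduct

namespace Literature.AlgebraicGeometry.Motives

namespace HodgeStructure

universe u

variable {V : Type u} [AddCommGroup V] [Module ℚ V] [Module.Finite ℚ V] [HodgeTensorFacts.{u, u}] {n : ℤ}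
variable {ι : Type*} [DecidableEq ι]

/-! ### §0 Admissible algebras preserve the blocks; the form is non-degenerate on every block -/

omit [Module.Finite ℚ V] [HodgeTensorFacts.{u, u}] [DecidableEq ι] in
/-- An element of `𝔤_ℂ` commutes with every `a ⊗ 1`, `a ∈ E`, when `𝔤` commutes with `E`. [cite: Zarhin1983HodgeGroupsK3, §2] -/
theorem GluedSp.commute_baseChange_of_mem_spanC (H : HodgeStructure V n) {𝔤 : Submodule ℚ (Module.End ℚ V)}
    (hcomm : ∀ X ∈ 𝔤, ∀ a : H.endAlg, X * (a : Module.End ℚ V) = (a : Module.End ℚ V) * X)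
    {Y : Module.End ℂ (ℂ ⊗[ℚ] V)} (hY : Y ∈ spanC 𝔤) (a : H.endAlg) :
    Y * (a : Module.End ℚ V).baseChange ℂ = (a : Module.End ℚ V).baseChange ℂ * Y := by
  refine (commute_of_mem_spanC (T := (a : Module.End ℚ V).baseChange ℂ) (fun X hX => ?_) hY).symm
  rw [← LinearMap.baseChange_mul, ← hcomm X hX a, LinearMap.baseChange_mul]

omit [Module.Finite ℚ V] [HodgeTensorFacts.{u, u}] [DecidableEq ι] in
/-- **Elements of `𝔤_ℂ` preserve every block** when `𝔤` commutes with `E` and the blocks are preserved by every operator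
commuting with `E_ℂ`. [cite: Zarhin1983HodgeGroupsK3, §2] [cite: Hazama1983, §3 (pp. 305–306)] -/
theorem GluedSp.apply_mem_block (H : HodgeStructure V n) (T : ι → Submodule ℂ (ℂ ⊗[ℚ] V))
    (hTE : ∀ Y : Module.End ℂ (ℂ ⊗[ℚ] V),
      (∀ a : H.endAlg, Y * (a : Module.End ℚ V).baseChange ℂ = (a : Module.End ℚ V).baseChange ℂ * Y) →
        ∀ p, Set.MapsTo Y (T p) (T p))
    {𝔤 : Submodule ℚ (Module.End ℚ V)}
    (hcomm : ∀ X ∈ 𝔤, ∀ a : H.endAlg, X * (a : Module.End ℚ V) = (a : Module.End ℚ V) * X)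
    {Y : Module.End ℂ (ℂ ⊗[ℚ] V)} (hY : Y ∈ spanC 𝔤) (p : ι) {x : ℂ ⊗[ℚ] V} (hx : x ∈ T p) : Y x ∈ T p :=
  hTE Y (GluedSp.commute_baseChange_of_mem_spanC H hcomm hY) p hx

omit [Module.Finite ℚ V] [HodgeTensorFacts.{u, u}] in
/-- **`ψ_ℂ` is non-degenerate on every block of an internal sum of mutually `ψ_ℂ`-orthogonal blocks.**
[cite: Hazama1983, §3 (pp. 305–306)] -/
theorem GluedSp.eq_zero_of_forall_block (H : HodgeStructure V n) (ψ : H.Polarization) (T : ι → Submodule ℂ (ℂ ⊗[ℚ] V))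
    (hint : DirectSum.IsInternal T)
    (horth : ∀ p p', p ≠ p' → ∀ x ∈ T p, ∀ y ∈ T p', ψ.form.baseChange ℂ x y = 0) (p : ι) {x : ℂ ⊗[ℚ] V}
    (hx : x ∈ T p) (h0 : ∀ y ∈ T p, ψ.form.baseChange ℂ x y = 0) : x = 0 := by
  refine ψ.eq_zero_of_forall_form_eq_zero fun y => ?_
  have hy : y ∈ ⨆ j, T j := by
    rw [hint.submodule_iSup_eq_top]
    exact Submodule.mem_top
  induction hy using Submodule.iSup_induction' with
  | mem j y hy =>
    by_cases hji : j = p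
    · subst hji
      exact h0 y hy
    · exact horth p j (Ne.symm hji) x hx y hy
  | zero => simp
  | add y y' _ _ hy hy' => rw [map_add, hy, hy', add_zero]

omit [Module.Finite ℚ V] [HodgeTensorFacts.{u, u}] in
/-- The block projector of an internal direct sum: `T_p` and `⨆_{p' ≠ p} T_{p'}` are complementary. [folklore] -/
private theorem GluedSp.isCompl_block (T : ι → Submodule ℂ (ℂ ⊗[ℚ] V)) (hint : DirectSum.IsInternal T) (p : ι) :
    IsCompl (T p) (⨆ (k) (_ : k ≠ p), T k) := by
  have hdisj : Disjoint (T p) (⨆ (k) (_ : k ≠ p), T k) := iSupIndep_def.1 hint.submodule_iSupIndep p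
  have hcod : T p ⊔ (⨆ (k) (_ : k ≠ p), T k) = ⊤ := by
    rw [← hint.submodule_iSup_eq_top, iSup_split_single (fun k => T k) p]
  exact ⟨hdisj, codisjoint_iff.2 hcod⟩

omit [Module.Finite ℚ V] [HodgeTensorFacts.{u, u}] [DecidableEq ι] in
/-- A block `T_{p'}`, `p' ≠ p`, lies in the complement `⨆_{k ≠ p} T_k`. [folklore] -/
private theorem GluedSp.le_iSup_ne (T : ι → Submodule ℂ (ℂ ⊗[ℚ] V)) {p p' : ι} (hp : p' ≠ p) :
    T p' ≤ ⨆ (k) (_ : k ≠ p), T k :=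
  fun _ hy => Submodule.mem_iSup_of_mem (p := fun k => ⨆ (_ : k ≠ p), T k) p'
    (Submodule.mem_iSup_of_mem (p := fun _ : p' ≠ p => T p') hp hy)

omit [Module.Finite ℚ V] [HodgeTensorFacts.{u, u}] [DecidableEq ι] in
/-- An operator preserving every block preserves the complement `⨆_{k ≠ p} T_k`. [folklore] -/
private theorem GluedSp.mapsTo_iSup_ne (T : ι → Submodule ℂ (ℂ ⊗[ℚ] V)) {Y : Module.End ℂ (ℂ ⊗[ℚ] V)}
    (hY : ∀ k, Set.MapsTo Y (T k) (T k)) (p : ι) {x : ℂ ⊗[ℚ] V} (hx : x ∈ ⨆ (k) (_ : k ≠ p), T k) :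
    Y x ∈ ⨆ (k) (_ : k ≠ p), T k := by
  have hle : (⨆ (k) (_ : k ≠ p), T k) ≤ Submodule.comap Y (⨆ (k) (_ : k ≠ p), T k) := by
    refine iSup₂_le fun k hk y hy => ?_
    rw [Submodule.mem_comap]
    exact GluedSp.le_iSup_ne T hk (hY k hy)
  exact hle hx

omit [Module.Finite ℚ V] [HodgeTensorFacts.{u, u}] in
/-- **The block projector commutes with every block-preserving operator.** [folklore] -/
private theorem GluedSp.projection_block_comm (T : ι → Submodule ℂ (ℂ ⊗[ℚ] V)) (hint : DirectSum.IsInternal T) (p : ι)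
    {Y : Module.End ℂ (ℂ ⊗[ℚ] V)} (hY : ∀ k, Set.MapsTo Y (T k) (T k)) :
    (T p).projection (⨆ (k) (_ : k ≠ p), T k) (GluedSp.isCompl_block T hint p) * Y =
      Y * (T p).projection (⨆ (k) (_ : k ≠ p), T k) (GluedSp.isCompl_block T hint p) := by
  have hc := GluedSp.isCompl_block T hint p
  refine LinearMap.ext fun x => ?_
  rw [Module.End.mul_apply, Module.End.mul_apply]
  have hx : x = (T p).projection _ hc x + (x - (T p).projection _ hc x) := by abel
  have h1 : (T p).projection _ hc x ∈ T p := Submodule.projection_apply_mem hc x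
  have h2 : Y (x - (T p).projection _ hc x) ∈ ⨆ (k) (_ : k ≠ p), T k :=
    GluedSp.mapsTo_iSup_ne T hY p (Submodule.sub_projection_mem hc x)
  conv_lhs => rw [hx]
  rw [map_add, map_add, Submodule.projection_apply_of_mem_left hc (hY p h1),
    (Submodule.projection_apply_eq_zero_iff hc).2 h2, add_zero]

/-! ### §1 Irreducibility of the blocks under an admissible algebra -/

omit [HodgeTensorFacts.{u, u}] in
/-- **Irreducibility of the blocks under an admissible algebra.** With `H` effective polarized of weight one, `ψ`, an
admissible `𝔤` with `Θ ∈ 𝔤_ℂ`, and blocks `T_p` preserved by `𝔤_ℂ` and separated by `E` only through scalars: a subspace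
`U ⊆ T_p` stable under the `X_ℂ`, `X ∈ 𝔤`, is `0` or `T_p`. The projector `π` onto `U` along its `𝔤`-stable complement
(`SpBlocksTheta.exists_isCompl_of_stable`) commutes with `𝔤`, and so does the block projector `Q_p`; hence `π ∘ Q_p` lies in `E_ℂ`
(descent, `ThetaSubalgebra.mem_span_endAlg_of_forall_commute`), preserves every block, and is therefore a scalar on `T_p`
(`hscal`) — `0` or `1`. Zarhin 1983 §2 «`T_σ` is an irreducible `Lie(Hdg)_ℂ`-module», for glued blocks.
[cite: Zarhin1983HodgeGroupsK3, §2] [cite: Deligne1982HodgeCycles, I §3 Prop. 3.4] -/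
theorem GluedSp.eq_bot_or_eq_block_of_stable (H : HodgeStructure V n) (hn : n = 1) (heff : H.IsEffective)
    (ψ : H.Polarization) (T : ι → Submodule ℂ (ℂ ⊗[ℚ] V)) (hint : DirectSum.IsInternal T)
    (hTE : ∀ Y : Module.End ℂ (ℂ ⊗[ℚ] V),
      (∀ a : H.endAlg, Y * (a : Module.End ℚ V).baseChange ℂ = (a : Module.End ℚ V).baseChange ℂ * Y) →
        ∀ p, Set.MapsTo Y (T p) (T p))
    (hscal : ∀ u ∈ Submodule.span ℂ ((fun a : Module.End ℚ V => a.baseChange ℂ) '' (H.endAlg : Set (Module.End ℚ V))),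
      (∀ p, Set.MapsTo u (T p) (T p)) → ∀ p, ∃ c : ℂ, ∀ x ∈ T p, u x = c • x)
    (𝔤 : Submodule ℚ (Module.End ℚ V)) {Θ : Module.End ℂ (ℂ ⊗[ℚ] V)}
    (hΘ : ∀ p, ∀ x ∈ H.piece p (n - p), Θ x = ((2 * p - n : ℤ) : ℂ) • x) (hΘ𝔤 : Θ ∈ spanC 𝔤)
    (hcomm : ∀ X ∈ 𝔤, ∀ a : H.endAlg, X * (a : Module.End ℚ V) = (a : Module.End ℚ V) * X)
    (hskew : ∀ X ∈ 𝔤, ∀ v w, ψ.form (X v) w + ψ.form v (X w) = 0) (p : ι)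
    {U : Submodule ℂ (ℂ ⊗[ℚ] V)} (hUT : U ≤ T p) (hU : ∀ X ∈ 𝔤, ∀ u ∈ U, X.baseChange ℂ u ∈ U) :
    U = ⊥ ∨ U = T p := by
  classical
  obtain ⟨U', hc, -, hπcomm⟩ := SpBlocksTheta.exists_isCompl_of_stable H hn heff ψ 𝔤 hΘ hΘ𝔤 hskew hU
  have hcT := GluedSp.isCompl_block T hint p
  set Q := (T p).projection (⨆ (k) (_ : k ≠ p), T k) hcT with hQ
  set π := U.projection U' hc with hπ
  have hXT : ∀ X ∈ 𝔤, ∀ k, Set.MapsTo (X.baseChange ℂ) (T k) (T k) := fun X hX k _ hx =>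
    GluedSp.apply_mem_block H T hTE hcomm (baseChange_mem_spanC hX) k hx
  have hQcomm : ∀ X ∈ 𝔤, Q * X.baseChange ℂ = X.baseChange ℂ * Q := fun X hX =>
    GluedSp.projection_block_comm T hint p (hXT X hX)
  have hπQcomm : ∀ X ∈ 𝔤, (π * Q) * X.baseChange ℂ = X.baseChange ℂ * (π * Q) := fun X hX => by
    rw [mul_assoc, hQcomm X hX, ← mul_assoc, hπcomm X hX, mul_assoc]
  have hπQspan := ThetaSubalgebra.mem_span_endAlg_of_forall_commute H 𝔤 hΘ hΘ𝔤 hπQcomm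
  have hπQT : ∀ k, Set.MapsTo (π * Q) (T k) (T k) := by
    intro k x hx
    rw [Module.End.mul_apply]
    by_cases hk : k = p
    · subst hk
      exact hUT (Submodule.projection_apply_mem hc _)
    · rw [hQ, (Submodule.projection_apply_eq_zero_iff hcT).2 (GluedSp.le_iSup_ne T hk hx), map_zero]
      exact Submodule.zero_mem _
  obtain ⟨c, hcs⟩ := hscal _ hπQspan hπQT p
  by_cases hU0 : U = ⊥
  · exact Or.inl hU0
  right
  obtain ⟨u₀, hu₀U, hu₀0⟩ := (Submodule.ne_bot_iff U).1 hU0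
  have hπQ_apply : ∀ x ∈ T p, (π * Q) x = π x := fun x hx => by
    rw [Module.End.mul_apply, hQ, Submodule.projection_apply_of_mem_left hcT hx]
  have hc1 : c = 1 := by
    have h : π u₀ = u₀ := Submodule.projection_apply_of_mem_left hc hu₀U
    rw [← hπQ_apply u₀ (hUT hu₀U), hcs u₀ (hUT hu₀U)] at h
    have h' : (c - 1) • u₀ = 0 := by rw [sub_smul, one_smul, h, sub_self]
    exact sub_eq_zero.1 ((smul_eq_zero.1 h').resolve_right hu₀0)
  refine le_antisymm hUT fun x hx => ?_
  have h := hcs x hx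
  rw [hc1, one_smul, hπQ_apply x hx] at h
  rw [← h]
  exact Submodule.projection_apply_mem hc x

omit [HodgeTensorFacts.{u, u}] in
/-- **Irreducibility, restricted form** (as consumed by the core theorem on a block): for a family `𝔊` of operators of `T_p`
containing the restriction of every element of `𝔤_ℂ`, a `𝔊`-stable subspace of `T_p` is `0` or `T_p`.
[cite: Zarhin1983HodgeGroupsK3, §2] -/
theorem GluedSp.eq_bot_or_top_of_stable (H : HodgeStructure V n) (hn : n = 1) (heff : H.IsEffective)
    (ψ : H.Polarization) (T : ι → Submodule ℂ (ℂ ⊗[ℚ] V)) (hint : DirectSum.IsInternal T)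
    (hTE : ∀ Y : Module.End ℂ (ℂ ⊗[ℚ] V),
      (∀ a : H.endAlg, Y * (a : Module.End ℚ V).baseChange ℂ = (a : Module.End ℚ V).baseChange ℂ * Y) →
        ∀ p, Set.MapsTo Y (T p) (T p))
    (hscal : ∀ u ∈ Submodule.span ℂ ((fun a : Module.End ℚ V => a.baseChange ℂ) '' (H.endAlg : Set (Module.End ℚ V))),
      (∀ p, Set.MapsTo u (T p) (T p)) → ∀ p, ∃ c : ℂ, ∀ x ∈ T p, u x = c • x)
    (𝔤 : Submodule ℚ (Module.End ℚ V)) {Θ : Module.End ℂ (ℂ ⊗[ℚ] V)}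
    (hΘ : ∀ p, ∀ x ∈ H.piece p (n - p), Θ x = ((2 * p - n : ℤ) : ℂ) • x) (hΘ𝔤 : Θ ∈ spanC 𝔤)
    (hcomm : ∀ X ∈ 𝔤, ∀ a : H.endAlg, X * (a : Module.End ℚ V) = (a : Module.End ℚ V) * X)
    (hskew : ∀ X ∈ 𝔤, ∀ v w, ψ.form (X v) w + ψ.form v (X w) = 0) (p : ι)
    (𝔊 : Submodule ℂ (Module.End ℂ ↥(T p)))
    (h𝔊 : ∀ Y ∈ spanC 𝔤, ∃ g ∈ 𝔊, ∀ x : T p, ((g x : T p) : ℂ ⊗[ℚ] V) = Y x)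
    (U : Submodule ℂ ↥(T p)) (hU : ∀ g ∈ 𝔊, ∀ u ∈ U, g u ∈ U) : U = ⊥ ∨ U = ⊤ := by
  set U' : Submodule ℂ (ℂ ⊗[ℚ] V) := U.map (T p).subtype with hU'
  have hU'le : U' ≤ T p := by
    rintro _ ⟨u, -, rfl⟩
    exact u.2
  have hU'stab : ∀ X ∈ 𝔤, ∀ x ∈ U', X.baseChange ℂ x ∈ U' := by
    rintro X hX _ ⟨u, hu, rfl⟩
    obtain ⟨g, hg, hgY⟩ := h𝔊 _ (baseChange_mem_spanC hX)
    exact ⟨g u, hU g hg u hu, hgY u⟩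
  rcases GluedSp.eq_bot_or_eq_block_of_stable H hn heff ψ T hint hTE hscal 𝔤 hΘ hΘ𝔤 hcomm hskew p hU'le hU'stab
    with h | h
  · left
    rw [eq_bot_iff]
    intro u hu
    rw [Submodule.mem_bot]
    have h1 : (u : ℂ ⊗[ℚ] V) ∈ U' := ⟨u, hu, rfl⟩
    rw [h, Submodule.mem_bot] at h1
    exact Subtype.ext h1
  · right
    rw [eq_top_iff]
    intro u _
    have hu : (u : ℂ ⊗[ℚ] V) ∈ U' := by rw [h]; exact u.2
    obtain ⟨u', hu', huu'⟩ := hu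
    have : u' = u := Subtype.ext huu'
    rw [← this]
    exact hu'

/-! ### §2 Block data; `𝔤_ℂ` restricts ONTO `𝔰𝔭(T_p)` on every block -/

/-- **Block data.** On each block `T = T_p` (real, four-dimensional, `ψ_ℂ`-orthogonal to the others, preserved by the operators
commuting with `E_ℂ`): the restricted form `ω = ψ_ℂ|_T` is non-degenerate and alternating, and the restriction `Θ|_T` of a
Hodge operator is an `ω`-skew involution whose eigenspaces `T ∩ V^{1,0}`, `T ∩ V^{0,1}` are planes (the tree's
`SymplecticBlocks.exists_blockData` for abstract blocks). [cite: Hazama1983, §3 (pp. 305–306)]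
[cite: MoonenZarhin1999LowDim, §2 (2.5) and §3 (3.1)] -/
theorem GluedSp.exists_blockData (H : HodgeStructure V n) (hn : n = 1) (heff : H.IsEffective) (ψ : H.Polarization)
    (T : ι → Submodule ℂ (ℂ ⊗[ℚ] V)) (hint : DirectSum.IsInternal T) (h4 : ∀ p, Module.finrank ℂ (T p) = 4)
    (hconj : ∀ p, ∀ x ∈ T p, conj x ∈ T p)
    (horth : ∀ p p', p ≠ p' → ∀ x ∈ T p, ∀ y ∈ T p', ψ.form.baseChange ℂ x y = 0)
    (hTE : ∀ Y : Module.End ℂ (ℂ ⊗[ℚ] V),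
      (∀ a : H.endAlg, Y * (a : Module.End ℚ V).baseChange ℂ = (a : Module.End ℚ V).baseChange ℂ * Y) →
        ∀ p, Set.MapsTo Y (T p) (T p))
    {Θ : Module.End ℂ (ℂ ⊗[ℚ] V)} (hΘ : ∀ p, ∀ x ∈ H.piece p (n - p), Θ x = ((2 * p - n : ℤ) : ℂ) • x) (i : ι) :
    ((ψ.form.baseChange ℂ).compl₁₂ (T i).subtype (T i).subtype).Nondegenerate ∧
    (∀ x y : T i, (ψ.form.baseChange ℂ).compl₁₂ (T i).subtype (T i).subtype x y =
      -(ψ.form.baseChange ℂ).compl₁₂ (T i).subtype (T i).subtype y x) ∧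
    ∃ (TΘ : Module.End ℂ ↥(T i)) (P Q : Submodule ℂ ↥(T i)),
      (∀ x : T i, ((TΘ x : T i) : ℂ ⊗[ℚ] V) = Θ x) ∧ (∀ v, TΘ (TΘ v) = v) ∧
      (∀ x y : T i, (ψ.form.baseChange ℂ).compl₁₂ (T i).subtype (T i).subtype (TΘ x) y +
        (ψ.form.baseChange ℂ).compl₁₂ (T i).subtype (T i).subtype x (TΘ y) = 0) ∧
      (∀ x ∈ P, TΘ x = x) ∧ (∀ x ∈ Q, TΘ x = -x) ∧ (∀ v, (2 : ℂ)⁻¹ • (v + TΘ v) ∈ P) ∧ (∀ v, (2 : ℂ)⁻¹ • (v - TΘ v) ∈ Q) ∧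
      Module.finrank ℂ P = 2 ∧ Module.finrank ℂ Q = 2 := by
  subst hn
  set T' := T i with hT'
  have hΘC : Θ ∈ H.hodgeLieC := H.mem_hodgeLieC_of_forall_piece hΘ
  obtain ⟨hPv, hQv, hΘ10, hΘ01, hΘΘ⟩ := UnitaryTheta.theta_facts H rfl heff hΘ
  have hΘT : ∀ x ∈ T', Θ x ∈ T' := fun x hx => hTE Θ (fun a => commute_baseChange_of_mem_hodgeLieC H hΘC a) i hx
  set ω : LinearMap.BilinForm ℂ ↥T' := (ψ.form.baseChange ℂ).compl₁₂ T'.subtype T'.subtype with hω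
  have hω_apply : ∀ x y : T', ω x y = ψ.form.baseChange ℂ (x : ℂ ⊗[ℚ] V) y := fun x y => rfl
  have hsepL : ∀ x : T', (∀ y : T', ω x y = 0) → x = 0 := by
    intro x hx
    exact Subtype.ext (GluedSp.eq_zero_of_forall_block H ψ T hint horth i x.2 fun y hy => by
      have h := hx ⟨y, hy⟩
      rwa [hω_apply] at h)
  have hωalt : ∀ x y : T', ω x y = -ω y x := fun x y => by
    rw [hω_apply, hω_apply, form_baseChange_swap_of_odd H odd_one ψ]
  refine ⟨⟨fun x hx => hsepL x hx, fun y hy => hsepL y fun x => by rw [hωalt, hy x, neg_zero]⟩, hωalt, ?_⟩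
  set TΘ : Module.End ℂ ↥T' := Θ.restrict fun x hx => hΘT x hx with hTΘ
  have hTΘ_coe : ∀ x : T', ((TΘ x : T') : ℂ ⊗[ℚ] V) = Θ x := fun x => rfl
  refine ⟨TΘ, (H.piece 1 0).comap T'.subtype, (H.piece 0 1).comap T'.subtype, hTΘ_coe,
    fun v => Subtype.ext (by rw [hTΘ_coe, hTΘ_coe, hΘΘ]), fun x y => ?_,
    fun x hx => Subtype.ext (by rw [hTΘ_coe]; exact hΘ10 _ hx),
    fun x hx => Subtype.ext (by rw [hTΘ_coe, Submodule.coe_neg]; exact hΘ01 _ hx), fun v => ?_, fun v => ?_, ?_, ?_⟩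
  · rw [hω_apply, hω_apply, hTΘ_coe, hTΘ_coe, formBaseChange_skew_of_mem_hodgeLieC ψ hΘC, neg_add_cancel]
  · change (((2 : ℂ)⁻¹ • (v + TΘ v) : T') : ℂ ⊗[ℚ] V) ∈ H.piece 1 0
    rw [Submodule.coe_smul, Submodule.coe_add, hTΘ_coe]
    exact hPv _
  · change (((2 : ℂ)⁻¹ • (v - TΘ v) : T') : ℂ ⊗[ℚ] V) ∈ H.piece 0 1
    rw [Submodule.coe_smul, Submodule.coe_sub, hTΘ_coe]
    exact hQv _
  · obtain ⟨hP2', -⟩ := SymplecticBlocks.finrank_inf_piece_eq_two H rfl heff hΘ (hconj i) hΘT (h4 i)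
    have hPeq : (H.piece 1 0).comap T'.subtype = (T' ⊓ H.piece 1 0).comap T'.subtype := by
      ext x
      simp only [Submodule.mem_comap, Submodule.coe_subtype, Submodule.mem_inf, SetLike.coe_mem, true_and]
    rw [hPeq, (Submodule.comapSubtypeEquivOfLe (inf_le_left : T' ⊓ H.piece 1 0 ≤ T')).finrank_eq, hP2']
  · obtain ⟨-, hQ2'⟩ := SymplecticBlocks.finrank_inf_piece_eq_two H rfl heff hΘ (hconj i) hΘT (h4 i)
    have hQeq : (H.piece 0 1).comap T'.subtype = (T' ⊓ H.piece 0 1).comap T'.subtype := by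
      ext x
      simp only [Submodule.mem_comap, Submodule.coe_subtype, Submodule.mem_inf, SetLike.coe_mem, true_and]
    rw [hQeq, (Submodule.comapSubtypeEquivOfLe (inf_le_left : T' ⊓ H.piece 0 1 ≤ T')).finrank_eq, hQ2']

/-- **`𝔤_ℂ` restricts onto `𝔰𝔭(T_p, ψ_ℂ|_{T_p})` on each four-dimensional real block, for EVERY admissible `𝔤`** (Moonen–Zarhin
1995 Type II «`Hg = Sp_D(V,φ)`» per block, for an arbitrary rational Lie algebra containing `Θ` after complexification).
For every `p` and every `ℂ`-linear `g : T_p → T_p` skew for `ψ_ℂ|_{T_p}` there is `Y ∈ 𝔤_ℂ` with `Y x = g x` on `T_p`: the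
restrictions `{Y|_{T_p}}` form a bracket-closed space of skew operators for the non-degenerate alternating `ψ_ℂ|_{T_p}`
containing the involution `Θ|_{T_p}` (eigen-planes `T_p ∩ V^{1,0}`, `T_p ∩ V^{0,1}`) and acting irreducibly (§1), so the core
theorem `SymplecticTheta.core_of_irreducible` for `T = ±Θ|_{T_p}` gives everything (the tree's
`SpBlocksTheta.exists_mem_spanC_restrict_eq`, verbatim but for the inputs). [cite: MoonenZarhin1995Duke, Type II]
[cite: MoonenZarhin1999LowDim, §2 (2.5) and §3 (3.1)] [cite: GoodmanWallachGTM255, §2.1.2] -/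
theorem GluedSp.exists_mem_spanC_restrict_eq (H : HodgeStructure V n) (hn : n = 1) (heff : H.IsEffective)
    (ψ : H.Polarization) (T : ι → Submodule ℂ (ℂ ⊗[ℚ] V)) (hint : DirectSum.IsInternal T)
    (h4 : ∀ p, Module.finrank ℂ (T p) = 4) (hconj : ∀ p, ∀ x ∈ T p, conj x ∈ T p)
    (horth : ∀ p p', p ≠ p' → ∀ x ∈ T p, ∀ y ∈ T p', ψ.form.baseChange ℂ x y = 0)
    (hTE : ∀ Y : Module.End ℂ (ℂ ⊗[ℚ] V),
      (∀ a : H.endAlg, Y * (a : Module.End ℚ V).baseChange ℂ = (a : Module.End ℚ V).baseChange ℂ * Y) →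
        ∀ p, Set.MapsTo Y (T p) (T p))
    (hscal : ∀ u ∈ Submodule.span ℂ ((fun a : Module.End ℚ V => a.baseChange ℂ) '' (H.endAlg : Set (Module.End ℚ V))),
      (∀ p, Set.MapsTo u (T p) (T p)) → ∀ p, ∃ c : ℂ, ∀ x ∈ T p, u x = c • x)
    (𝔤 : Submodule ℚ (Module.End ℚ V)) (hbr : ∀ X ∈ 𝔤, ∀ X' ∈ 𝔤, X * X' - X' * X ∈ 𝔤) {Θ : Module.End ℂ (ℂ ⊗[ℚ] V)}
    (hΘ : ∀ p, ∀ x ∈ H.piece p (n - p), Θ x = ((2 * p - n : ℤ) : ℂ) • x) (hΘ𝔤 : Θ ∈ spanC 𝔤)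
    (hcomm : ∀ X ∈ 𝔤, ∀ a : H.endAlg, X * (a : Module.End ℚ V) = (a : Module.End ℚ V) * X)
    (hskew : ∀ X ∈ 𝔤, ∀ v w, ψ.form (X v) w + ψ.form v (X w) = 0) (i : ι) :
    ∀ g : Module.End ℂ ↥(T i),
      (∀ x y : T i, ψ.form.baseChange ℂ ((g x : T i) : ℂ ⊗[ℚ] V) y +
        ψ.form.baseChange ℂ (x : ℂ ⊗[ℚ] V) ((g y : T i) : ℂ ⊗[ℚ] V) = 0) →
      ∃ Y ∈ spanC 𝔤, ∀ x : T i, ((g x : T i) : ℂ ⊗[ℚ] V) = Y x := by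
  classical
  subst hn
  obtain ⟨hωnd, hωalt, TΘ, P, Q, hTΘ_coe, hTΘΘ, hTΘskew, hP, hQ, hPmem, hQmem, hP2, hQ2⟩ :=
    GluedSp.exists_blockData H rfl heff ψ T hint h4 hconj horth hTE hΘ i
  intro g hg
  have hYT : ∀ Y ∈ spanC 𝔤, ∀ x ∈ T i, Y x ∈ (T i) := fun Y hY x hx => GluedSp.apply_mem_block H T hTE hcomm hY i hx
  have hYskew : ∀ Y ∈ spanC 𝔤, ∀ x y, ψ.form.baseChange ℂ (Y x) y + ψ.form.baseChange ℂ x (Y y) = 0 :=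
    fun Y hY => ThetaSubalgebra.formBaseChange_add_eq_zero_of_mem_spanC ψ hskew hY
  -- the restricted form `ω`
  set ω : LinearMap.BilinForm ℂ ↥(T i) := (ψ.form.baseChange ℂ).compl₁₂ (T i).subtype (T i).subtype with hω
  have hω_apply : ∀ x y : T i, ω x y = ψ.form.baseChange ℂ (x : ℂ ⊗[ℚ] V) y := fun x y => rfl
  -- the Lie algebra of restrictions
  let 𝔊 : Submodule ℂ (Module.End ℂ ↥(T i)) :=
    { carrier := {g' | ∃ Y ∈ spanC 𝔤, ∀ x : T i, ((g' x : T i) : ℂ ⊗[ℚ] V) = Y x}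
      zero_mem' := ⟨0, Submodule.zero_mem _, fun x => by simp⟩
      add_mem' := by
        rintro g₁ g₂ ⟨Y₁, hY₁, h₁⟩ ⟨Y₂, hY₂, h₂⟩
        exact ⟨Y₁ + Y₂, Submodule.add_mem _ hY₁ hY₂, fun x => by
          rw [LinearMap.add_apply, Submodule.coe_add, h₁, h₂, LinearMap.add_apply]⟩
      smul_mem' := by
        rintro c g' ⟨Y, hY, h⟩
        exact ⟨c • Y, Submodule.smul_mem _ c hY, fun x => by
          rw [LinearMap.smul_apply, Submodule.coe_smul, h, LinearMap.smul_apply]⟩ }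
  have hmem𝔊 : ∀ g', g' ∈ 𝔊 ↔ ∃ Y ∈ spanC 𝔤, ∀ x : T i, ((g' x : T i) : ℂ ⊗[ℚ] V) = Y x := fun g' => Iff.rfl
  have hrestr : ∀ Y ∈ spanC 𝔤, ∃ g' ∈ 𝔊, ∀ x : T i, ((g' x : T i) : ℂ ⊗[ℚ] V) = Y x := fun Y hY =>
    ⟨Y.restrict fun x hx => hYT Y hY x hx, (hmem𝔊 _).2 ⟨Y, hY, fun x => rfl⟩, fun x => rfl⟩
  have h𝔊br : ∀ g₁ ∈ 𝔊, ∀ g₂ ∈ 𝔊, g₁ * g₂ - g₂ * g₁ ∈ 𝔊 := by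
    rintro g₁ ⟨Y₁, hY₁, h₁⟩ g₂ ⟨Y₂, hY₂, h₂⟩
    refine (hmem𝔊 _).2 ⟨Y₁ * Y₂ - Y₂ * Y₁, commutator_mem_spanC hbr hY₁ hY₂, fun x => ?_⟩
    rw [LinearMap.sub_apply, Submodule.coe_sub, Module.End.mul_apply, Module.End.mul_apply, h₁, h₂, h₂, h₁,
      LinearMap.sub_apply, Module.End.mul_apply, Module.End.mul_apply]
  have h𝔊skew : ∀ g' ∈ 𝔊, ∀ x y : T i, ω (g' x) y + ω x (g' y) = 0 := by
    rintro g' ⟨Y, hY, h⟩ x y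
    rw [hω_apply, hω_apply, h, h]
    exact hYskew Y hY _ _
  -- the involution `Θ|_T` lies in `𝔊`
  have hTΘ𝔊 : TΘ ∈ 𝔊 := (hmem𝔊 _).2 ⟨Θ, hΘ𝔤, hTΘ_coe⟩
  -- irreducibility
  have hirr : ∀ U : Submodule ℂ ↥(T i), (∀ Z ∈ 𝔊, ∀ u ∈ U, Z u ∈ U) → U = ⊥ ∨ U = ⊤ :=
    fun U hU => GluedSp.eq_bot_or_top_of_stable H rfl heff ψ T hint hTE hscal 𝔤 hΘ hΘ𝔤 hcomm hskew i 𝔊 hrestr U hU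
  -- the core theorem for `T = Θ|_T` and `T = -Θ|_T`
  have hnΘ𝔊 : -TΘ ∈ 𝔊 := (hmem𝔊 _).2 ⟨-Θ, Submodule.neg_mem _ hΘ𝔤, fun x => by
    rw [LinearMap.neg_apply, Submodule.coe_neg, hTΘ_coe, LinearMap.neg_apply]⟩
  have hnΘΘ : ∀ v : T i, (-TΘ) ((-TΘ) v) = v := fun v => by
    rw [LinearMap.neg_apply, LinearMap.neg_apply, map_neg, neg_neg, hTΘΘ]
  have hP' : ∀ x ∈ Q, (-TΘ) x = x := fun x hx => by rw [LinearMap.neg_apply, hQ x hx, neg_neg]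
  have hQ' : ∀ x ∈ P, (-TΘ) x = -x := fun x hx => by rw [LinearMap.neg_apply, hP x hx]
  have hPmem' : ∀ v : T i, (2 : ℂ)⁻¹ • (v + (-TΘ) v) ∈ Q := fun v => by
    rw [LinearMap.neg_apply, ← sub_eq_add_neg]; exact hQmem v
  have hQmem' : ∀ v : T i, (2 : ℂ)⁻¹ • (v - (-TΘ) v) ∈ P := fun v => by
    rw [LinearMap.neg_apply, sub_neg_eq_add]; exact hPmem v
  obtain ⟨hA, hB⟩ := SymplecticTheta.core_of_irreducible ω hωnd hωalt 𝔊 h𝔊br h𝔊skew hTΘ𝔊 hTΘΘ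
    (P := P) (Q := Q) hP hQ hPmem hQmem hP2 hQ2 hirr
  obtain ⟨hA', -⟩ := SymplecticTheta.core_of_irreducible ω hωnd hωalt 𝔊 h𝔊br h𝔊skew hnΘ𝔊 hnΘΘ
    (P := Q) (Q := P) hP' hQ' hPmem' hQmem' hQ2 hP2 hirr
  -- the space of `ω`-skew operators on `T` and the grading of `g`
  let 𝔰 : Submodule ℂ (Module.End ℂ ↥(T i)) :=
    { carrier := {Z | ∀ x y : T i, ω (Z x) y + ω x (Z y) = 0}
      zero_mem' := fun x y => by simp
      add_mem' := by
        intro Z Z' hZ hZ' x y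
        simp only [LinearMap.add_apply, map_add]
        have h1 := hZ x y
        have h2 := hZ' x y
        linear_combination h1 + h2
      smul_mem' := by
        intro c Z hZ x y
        simp only [LinearMap.smul_apply, map_smul, smul_eq_mul]
        have h1 := hZ x y
        linear_combination c * h1 }
  have hmem𝔰 : ∀ Z, Z ∈ 𝔰 ↔ ∀ x y : T i, ω (Z x) y + ω x (Z y) = 0 := fun Z => Iff.rfl
  have h𝔰br : ∀ Z ∈ 𝔰, ∀ Z' ∈ 𝔰, Z * Z' - Z' * Z ∈ 𝔰 := by
    intro Z hZ Z' hZ' x y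
    simp only [LinearMap.sub_apply, Module.End.mul_apply, map_sub, LinearMap.sub_apply]
    have h1 := (hmem𝔰 Z).1 hZ (Z' x) y
    have h2 := (hmem𝔰 Z').1 hZ' x (Z y)
    have h3 := (hmem𝔰 Z').1 hZ' (Z x) y
    have h4 := (hmem𝔰 Z).1 hZ x (Z' y)
    linear_combination h1 - h3 + h4 - h2
  have hΘ𝔰 : TΘ ∈ 𝔰 := (hmem𝔰 TΘ).2 (h𝔊skew TΘ hTΘ𝔊)
  have hg𝔰 : g ∈ 𝔰 := (hmem𝔰 g).2 fun x y => by rw [hω_apply, hω_apply]; exact hg x y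
  obtain ⟨Ym, hYm, Y0, hY0, Yp, hYp, hYeq, hYpP, hYpim, hYmQ, hYmim, -, -, hY0P, hY0Q⟩ :=
    SymplecticTheta.exists_decomp 𝔰 h𝔰br hΘ𝔰 hTΘΘ (P := P) (Q := Q) hP hQ hPmem hQmem hg𝔰
  have hg𝔊 : g ∈ 𝔊 := by
    rw [hYeq]
    refine Submodule.add_mem _ (Submodule.add_mem _ ?_ ?_) ?_
    · exact hA' Ym ((hmem𝔰 Ym).1 hYm) hYmQ hYmim
    · exact hB Y0 ((hmem𝔰 Y0).1 hY0) hY0P hY0Q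
    · exact hA Yp ((hmem𝔰 Yp).1 hYp) hYpP hYpim
  exact (hmem𝔊 g).1 hg𝔊

/-! ### §3 Ideals of `𝔤_ℂ` on a block; `𝔤_ℂ` is semisimple -/

/-- **An ideal of `𝔤_ℂ` either kills the block `T_j` or restricts ONTO `𝔰𝔭(T_j)`** (its restrictions form an ideal of
`𝔰𝔭(T_j) = c_j(𝔤_ℂ)` by §2, and «`𝔰𝔭₄` is simple», `SymplecticIdeal.mem_of_ne_bot`); the tree's
`SymplecticBlocks.restrict_ideal_dichotomy` for an arbitrary admissible algebra. [cite: MoonenZarhin1999LowDim, §3 (3.1) and Lemma (3.4)]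
[cite: Humphreys1972, §5.2] -/
theorem GluedSp.restrict_ideal_dichotomy (H : HodgeStructure V n) (hn : n = 1) (heff : H.IsEffective)
    (ψ : H.Polarization)
    (T : ι → Submodule ℂ (ℂ ⊗[ℚ] V)) (hint : DirectSum.IsInternal T)
    (h4 : ∀ p, Module.finrank ℂ (T p) = 4) (hconj : ∀ p, ∀ x ∈ T p, conj x ∈ T p)
    (horth : ∀ p p', p ≠ p' → ∀ x ∈ T p, ∀ y ∈ T p', ψ.form.baseChange ℂ x y = 0)
    (hTE : ∀ Y : Module.End ℂ (ℂ ⊗[ℚ] V),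
      (∀ a : H.endAlg, Y * (a : Module.End ℚ V).baseChange ℂ = (a : Module.End ℚ V).baseChange ℂ * Y) →
        ∀ p, Set.MapsTo Y (T p) (T p))
    (hscal : ∀ u ∈ Submodule.span ℂ ((fun a : Module.End ℚ V => a.baseChange ℂ) '' (H.endAlg : Set (Module.End ℚ V))),
      (∀ p, Set.MapsTo u (T p) (T p)) → ∀ p, ∃ c : ℂ, ∀ x ∈ T p, u x = c • x)
    (𝔤 : Submodule ℚ (Module.End ℚ V)) (hbr : ∀ X ∈ 𝔤, ∀ X' ∈ 𝔤, X * X' - X' * X ∈ 𝔤) {Θ : Module.End ℂ (ℂ ⊗[ℚ] V)}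
    (hΘ : ∀ p, ∀ x ∈ H.piece p (n - p), Θ x = ((2 * p - n : ℤ) : ℂ) • x) (hΘ𝔤 : Θ ∈ spanC 𝔤)
    (hcomm : ∀ X ∈ 𝔤, ∀ a : H.endAlg, X * (a : Module.End ℚ V) = (a : Module.End ℚ V) * X)
    (hskew : ∀ X ∈ 𝔤, ∀ v w, ψ.form (X v) w + ψ.form v (X w) = 0)
    (N : Submodule ℂ (Module.End ℂ (ℂ ⊗[ℚ] V))) (hN : N ≤ spanC 𝔤)
    (hNideal : ∀ W ∈ spanC 𝔤, ∀ Y ∈ N, W * Y - Y * W ∈ N) (j : ι) :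
    (∀ Y ∈ N, ∀ x ∈ T j, Y x = 0) ∨
      ∀ g : Module.End ℂ ↥(T j),
        (∀ x y : T j, ψ.form.baseChange ℂ ((g x : T j) : ℂ ⊗[ℚ] V) y +
          ψ.form.baseChange ℂ (x : ℂ ⊗[ℚ] V) ((g y : T j) : ℂ ⊗[ℚ] V) = 0) →
        ∃ Y ∈ N, ∀ x : T j, ((g x : T j) : ℂ ⊗[ℚ] V) = Y x := by
  classical
  obtain ⟨hωnd, hωalt, TΘ, P, Q, hTΘ, hTT, hTskew, hP, hQ, hPmem, hQmem, hP2, hQ2⟩ :=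
    GluedSp.exists_blockData H hn heff ψ T hint h4 hconj horth hTE hΘ j
  set ω : LinearMap.BilinForm ℂ ↥(T j) := (ψ.form.baseChange ℂ).compl₁₂ (T j).subtype (T j).subtype with hω
  have hω_apply : ∀ x y : (T j), ω x y = ψ.form.baseChange ℂ (x : ℂ ⊗[ℚ] V) y := fun x y => rfl
  have hYT : ∀ Y ∈ spanC 𝔤, ∀ x ∈ (T j), Y x ∈ T j := fun Y hY x hx => GluedSp.apply_mem_block H T hTE hcomm hY j hx
  have hYskew : ∀ Y ∈ spanC 𝔤, ∀ x y, ψ.form.baseChange ℂ (Y x) y + ψ.form.baseChange ℂ x (Y y) = 0 :=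
    fun Y hY => ThetaSubalgebra.formBaseChange_add_eq_zero_of_mem_spanC ψ hskew hY
  -- the restrictions of `N`
  let I : Submodule ℂ (Module.End ℂ ↥(T j)) :=
    { carrier := {g | ∃ Y ∈ N, ∀ x : (T j), ((g x : (T j)) : ℂ ⊗[ℚ] V) = Y x}
      zero_mem' := ⟨0, N.zero_mem, fun x => by simp⟩
      add_mem' := by
        rintro g₁ g₂ ⟨Y₁, hY₁, h₁⟩ ⟨Y₂, hY₂, h₂⟩
        exact ⟨Y₁ + Y₂, N.add_mem hY₁ hY₂, fun x => by rw [LinearMap.add_apply, Submodule.coe_add, h₁, h₂, LinearMap.add_apply]⟩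
      smul_mem' := by
        rintro c g ⟨Y, hY, h⟩
        exact ⟨c • Y, N.smul_mem c hY, fun x => by rw [LinearMap.smul_apply, Submodule.coe_smul, h, LinearMap.smul_apply]⟩ }
  have hmemI : ∀ g, g ∈ I ↔ ∃ Y ∈ N, ∀ x : (T j), ((g x : (T j)) : ℂ ⊗[ℚ] V) = Y x := fun g => Iff.rfl
  have hIskew : ∀ g ∈ I, ∀ x y : (T j), ω (g x) y + ω x (g y) = 0 := by
    rintro g ⟨Y, hY, h⟩ x y
    rw [hω_apply, hω_apply, h, h]
    exact hYskew Y (hN hY) _ _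
  -- `I` is an ideal of `𝔰𝔭((T j))`: every skew `Z` on `(T j)` is a restriction of some `W ∈ 𝔤_ℂ` (§2)
  have hI : ∀ Z : Module.End ℂ ↥(T j), (∀ x y : (T j), ω (Z x) y + ω x (Z y) = 0) → ∀ g ∈ I, Z * g - g * Z ∈ I := by
    rintro Z hZ g ⟨Y, hY, h⟩
    obtain ⟨W, hW, hWZ⟩ := GluedSp.exists_mem_spanC_restrict_eq H hn heff ψ T hint h4 hconj horth hTE hscal 𝔤 hbr hΘ hΘ𝔤
      hcomm hskew j Z (fun x y => by rw [← hω_apply, ← hω_apply]; exact hZ x y)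
    refine (hmemI _).2 ⟨W * Y - Y * W, hNideal W hW Y hY, fun x => ?_⟩
    rw [LinearMap.sub_apply, Submodule.coe_sub, Module.End.mul_apply, Module.End.mul_apply, hWZ, h, h, hWZ, LinearMap.sub_apply,
      Module.End.mul_apply, Module.End.mul_apply]
  by_cases hI0 : I = ⊥
  · left
    intro Y hY x hx
    have hg : Y.restrict (fun x hx => hYT Y (hN hY) x hx) ∈ I := (hmemI _).2 ⟨Y, hY, fun x => rfl⟩
    rw [hI0, Submodule.mem_bot] at hg
    have h := congrArg (fun g : Module.End ℂ ↥(T j) => ((g ⟨x, hx⟩ : (T j)) : ℂ ⊗[ℚ] V)) hg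
    simpa using h
  · right
    intro g hg
    have hgI : g ∈ I := SymplecticIdeal.mem_of_ne_bot ω hωnd hωalt hTT hTskew hP hQ hPmem hQmem hP2 hQ2 I hIskew hI hI0
      (fun x y => by rw [hω_apply, hω_apply]; exact hg x y)
    exact (hmemI g).1 hgI

/-- **An element of `𝔤_ℂ` whose restriction to `T_j` commutes with the restrictions of a subspace `N` that restricts ONTO
`𝔰𝔭(T_j)` kills `T_j`** («`𝔰𝔭₄` has trivial centre», `SymplecticIdeal.eq_zero_of_forall_bracket_eq_zero`); the tree's
`SymplecticBlocks.apply_eq_zero_of_forall_commute` for an admissible algebra. [cite: MoonenZarhin1999LowDim, §3 (3.1) and Lemma (3.4)]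
[cite: Humphreys1972, §5.2] -/
theorem GluedSp.apply_eq_zero_of_forall_commute (H : HodgeStructure V n) (hn : n = 1) (heff : H.IsEffective)
    (ψ : H.Polarization)
    (T : ι → Submodule ℂ (ℂ ⊗[ℚ] V)) (hint : DirectSum.IsInternal T)
    (h4 : ∀ p, Module.finrank ℂ (T p) = 4) (hconj : ∀ p, ∀ x ∈ T p, conj x ∈ T p)
    (horth : ∀ p p', p ≠ p' → ∀ x ∈ T p, ∀ y ∈ T p', ψ.form.baseChange ℂ x y = 0)
    (hTE : ∀ Y : Module.End ℂ (ℂ ⊗[ℚ] V),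
      (∀ a : H.endAlg, Y * (a : Module.End ℚ V).baseChange ℂ = (a : Module.End ℚ V).baseChange ℂ * Y) →
        ∀ p, Set.MapsTo Y (T p) (T p))
    (𝔤 : Submodule ℚ (Module.End ℚ V)) {Θ : Module.End ℂ (ℂ ⊗[ℚ] V)}
    (hΘ : ∀ p, ∀ x ∈ H.piece p (n - p), Θ x = ((2 * p - n : ℤ) : ℂ) • x)
    (hcomm : ∀ X ∈ 𝔤, ∀ a : H.endAlg, X * (a : Module.End ℚ V) = (a : Module.End ℚ V) * X)
    (hskew : ∀ X ∈ 𝔤, ∀ v w, ψ.form (X v) w + ψ.form v (X w) = 0) (j : ι)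
    (N : Submodule ℂ (Module.End ℂ (ℂ ⊗[ℚ] V)))
    (hNonto : ∀ g : Module.End ℂ ↥(T j),
        (∀ x y : T j, ψ.form.baseChange ℂ ((g x : T j) : ℂ ⊗[ℚ] V) y +
          ψ.form.baseChange ℂ (x : ℂ ⊗[ℚ] V) ((g y : T j) : ℂ ⊗[ℚ] V) = 0) →
        ∃ Y ∈ N, ∀ x : T j, ((g x : T j) : ℂ ⊗[ℚ] V) = Y x)
    {Z : Module.End ℂ (ℂ ⊗[ℚ] V)} (hZ : Z ∈ spanC 𝔤) (hc : ∀ Y ∈ N, ∀ x ∈ T j, (Y * Z - Z * Y) x = 0)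
    {x : ℂ ⊗[ℚ] V} (hx : x ∈ T j) : Z x = 0 := by
  classical
  obtain ⟨hωnd, hωalt, TΘ, P, Q, hTΘ, hTT, hTskew, hP, hQ, hPmem, hQmem, hP2, hQ2⟩ :=
    GluedSp.exists_blockData H hn heff ψ T hint h4 hconj horth hTE hΘ j
  set ω : LinearMap.BilinForm ℂ ↥(T j) := (ψ.form.baseChange ℂ).compl₁₂ (T j).subtype (T j).subtype with hω
  have hω_apply : ∀ x y : (T j), ω x y = ψ.form.baseChange ℂ (x : ℂ ⊗[ℚ] V) y := fun x y => rfl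
  have hYT : ∀ Y ∈ spanC 𝔤, ∀ x ∈ (T j), Y x ∈ T j := fun Y hY x hx => GluedSp.apply_mem_block H T hTE hcomm hY j hx
  set ZT : Module.End ℂ ↥(T j) := Z.restrict fun x hx => hYT Z hZ x hx with hZT
  have hZT_coe : ∀ x : (T j), ((ZT x : (T j)) : ℂ ⊗[ℚ] V) = Z x := fun x => rfl
  have hZTskew : ∀ x y : (T j), ω (ZT x) y + ω x (ZT y) = 0 := fun x y => by
    rw [hω_apply, hω_apply, hZT_coe, hZT_coe]
    exact ThetaSubalgebra.formBaseChange_add_eq_zero_of_mem_spanC ψ hskew hZ _ _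
  have h0 : ZT = 0 := by
    refine SymplecticIdeal.eq_zero_of_forall_bracket_eq_zero ω hωnd hωalt hTT hTskew hP hQ hPmem hQmem hP2 hQ2 hZTskew fun W hW => ?_
    obtain ⟨Y, hY, hYW⟩ := hNonto W fun x y => by rw [← hω_apply, ← hω_apply]; exact hW x y
    refine LinearMap.ext fun y => Subtype.ext ?_
    rw [LinearMap.sub_apply, Submodule.coe_sub, Module.End.mul_apply, Module.End.mul_apply, hYW, hZT_coe, hZT_coe, hYW,
      LinearMap.zero_apply, Submodule.coe_zero]
    have h := hc Y hY y y.2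
    rwa [LinearMap.sub_apply, Module.End.mul_apply, Module.End.mul_apply] at h
  have h := hZT_coe ⟨x, hx⟩
  rw [h0, LinearMap.zero_apply, Submodule.coe_zero] at h
  exact h.symm

/-- **`𝔤_ℂ` is a SEMISIMPLE Lie algebra** (four-dimensional real blocks, `𝔤` admissible): `V_ℂ` is a faithful completely
reducible `𝔏`-module, so the radical is central (Lie's theorem, `Literature.Algebra.Lie.hasCentralRadical_of_complementedLattice`);
a central element commutes on every block with `𝔤_ℂ|_{T_j} = 𝔰𝔭(T_j)` and therefore kills every block (trivial centre of `𝔰𝔭₄`);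
Cartan's criterion. For `𝔤 = Lie Hg` this is the tree's `SymplecticBlocks.isSemisimple_of_eq_hodgeLieC` (Moonen–Zarhin §1
«if `X` has no factors of Type 4 then `Hg(X)` is semi-simple»). [cite: MoonenZarhin1999LowDim, §3 (3.1) and Lemma (3.4)]
[cite: Deligne1982HodgeCycles, I §3 Prop. 3.4] [cite: Humphreys1972, §5.2] -/
theorem GluedSp.isSemisimple (H : HodgeStructure V n) (hn : n = 1) (heff : H.IsEffective) (ψ : H.Polarization)
    (T : ι → Submodule ℂ (ℂ ⊗[ℚ] V)) (hint : DirectSum.IsInternal T)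
    (h4 : ∀ p, Module.finrank ℂ (T p) = 4) (hconj : ∀ p, ∀ x ∈ T p, conj x ∈ T p)
    (horth : ∀ p p', p ≠ p' → ∀ x ∈ T p, ∀ y ∈ T p', ψ.form.baseChange ℂ x y = 0)
    (hTE : ∀ Y : Module.End ℂ (ℂ ⊗[ℚ] V),
      (∀ a : H.endAlg, Y * (a : Module.End ℚ V).baseChange ℂ = (a : Module.End ℚ V).baseChange ℂ * Y) →
        ∀ p, Set.MapsTo Y (T p) (T p))
    (hscal : ∀ u ∈ Submodule.span ℂ ((fun a : Module.End ℚ V => a.baseChange ℂ) '' (H.endAlg : Set (Module.End ℚ V))),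
      (∀ p, Set.MapsTo u (T p) (T p)) → ∀ p, ∃ c : ℂ, ∀ x ∈ T p, u x = c • x)
    (𝔤 : Submodule ℚ (Module.End ℚ V)) (hbr : ∀ X ∈ 𝔤, ∀ X' ∈ 𝔤, X * X' - X' * X ∈ 𝔤) {Θ : Module.End ℂ (ℂ ⊗[ℚ] V)}
    (hΘ : ∀ p, ∀ x ∈ H.piece p (n - p), Θ x = ((2 * p - n : ℤ) : ℂ) • x) (hΘ𝔤 : Θ ∈ spanC 𝔤)
    (hcomm : ∀ X ∈ 𝔤, ∀ a : H.endAlg, X * (a : Module.End ℚ V) = (a : Module.End ℚ V) * X)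
    (hskew : ∀ X ∈ 𝔤, ∀ v w, ψ.form (X v) w + ψ.form v (X w) = 0) :
    letI : LieRing (Module.End ℂ (ℂ ⊗[ℚ] V)) := LieRing.ofAssociativeRing
    ∀ (𝔏 : LieSubalgebra ℂ (Module.End ℂ (ℂ ⊗[ℚ] V))), 𝔏.toSubmodule = spanC 𝔤 → LieAlgebra.IsSemisimple ℂ 𝔏 := by
  letI : LieRing (Module.End ℂ (ℂ ⊗[ℚ] V)) := LieRing.ofAssociativeRing
  intro 𝔏 h𝔏
  haveI := SpBlocksTheta.complementedLattice_lieSubmodule H hn heff ψ 𝔤 hΘ hΘ𝔤 hskew 𝔏 h𝔏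
  haveI : Module.Finite ℂ 𝔏 := Module.Finite.of_injective 𝔏.toSubmodule.subtype Subtype.val_injective
  have hmem : ∀ Y : Module.End ℂ (ℂ ⊗[ℚ] V), Y ∈ spanC 𝔤 ↔ Y ∈ 𝔏 := fun Y => by
    rw [← LieSubalgebra.mem_toSubmodule, h𝔏]
  -- the centre vanishes
  have hcenter : LieAlgebra.center ℂ 𝔏 = ⊥ := by
    rw [eq_bot_iff]
    intro Z hZ
    rw [LieSubmodule.mem_bot]
    have hZc : ∀ Y ∈ spanC 𝔤, Y * (Z : Module.End ℂ (ℂ ⊗[ℚ] V)) - (Z : Module.End ℂ (ℂ ⊗[ℚ] V)) * Y = 0 := by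
      intro Y hY
      have h := (LieModule.mem_maxTrivSubmodule ℂ 𝔏 𝔏 Z).1 hZ ⟨Y, (hmem Y).1 hY⟩
      have h' := congrArg Subtype.val h
      rwa [LieSubalgebra.coe_bracket, LieRing.of_associative_ring_bracket] at h'
    have hZ0 : (Z : Module.End ℂ (ℂ ⊗[ℚ] V)) = 0 := by
      refine LinearMap.ext fun v => ?_
      have hv : v ∈ ⨆ j, T j := by
        rw [hint.submodule_iSup_eq_top]
        exact Submodule.mem_top
      rw [LinearMap.zero_apply]
      induction hv using Submodule.iSup_induction' with
      | mem j x hx =>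
        exact GluedSp.apply_eq_zero_of_forall_commute H hn heff ψ T hint h4 hconj horth hTE 𝔤 hΘ hcomm hskew j (spanC 𝔤)
          (GluedSp.exists_mem_spanC_restrict_eq H hn heff ψ T hint h4 hconj horth hTE hscal 𝔤 hbr hΘ hΘ𝔤 hcomm hskew j)
          ((hmem _).2 Z.2) (fun Y hY y _ => by rw [hZc Y hY, LinearMap.zero_apply]) hx
      | zero => simp
      | add x y _ _ hx hy => rw [map_add, hx, hy, add_zero]
    exact Subtype.ext hZ0
  exact Literature.Algebra.Lie.isSemisimple_of_complementedLattice_of_center_eq_bot (k := ℂ) (L := 𝔏) (M := ℂ ⊗[ℚ] V) hcenter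

/-! ### §4 The Goursat step: complementary ideals, no intertwiners between distinct blocks, supported lifts -/

/-- **The complementary ideal `N` of `M_i = ker c_i` in the semisimple Lie algebra `𝔤_ℂ`**, as a subspace of `End(V_ℂ)`:
`N ⊆ 𝔤_ℂ` is an ideal, every element of `𝔤_ℂ` agrees on `T_i` with a unique element of `N`, and `[M_i, N] = 0` (Boolean
algebra of ideals of a semisimple Lie algebra, Mathlib; §3). The tree's `SymplecticBlocks.exists_complement_ideal` for an
admissible algebra. [cite: Humphreys1972, §5.2] [cite: MoonenZarhin1999LowDim, §3 (3.1) and Lemma (3.4)] -/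
theorem GluedSp.exists_complement_ideal (H : HodgeStructure V n) (hn : n = 1) (heff : H.IsEffective)
    (ψ : H.Polarization)
    (T : ι → Submodule ℂ (ℂ ⊗[ℚ] V)) (hint : DirectSum.IsInternal T)
    (h4 : ∀ p, Module.finrank ℂ (T p) = 4) (hconj : ∀ p, ∀ x ∈ T p, conj x ∈ T p)
    (horth : ∀ p p', p ≠ p' → ∀ x ∈ T p, ∀ y ∈ T p', ψ.form.baseChange ℂ x y = 0)
    (hTE : ∀ Y : Module.End ℂ (ℂ ⊗[ℚ] V),
      (∀ a : H.endAlg, Y * (a : Module.End ℚ V).baseChange ℂ = (a : Module.End ℚ V).baseChange ℂ * Y) →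
        ∀ p, Set.MapsTo Y (T p) (T p))
    (hscal : ∀ u ∈ Submodule.span ℂ ((fun a : Module.End ℚ V => a.baseChange ℂ) '' (H.endAlg : Set (Module.End ℚ V))),
      (∀ p, Set.MapsTo u (T p) (T p)) → ∀ p, ∃ c : ℂ, ∀ x ∈ T p, u x = c • x)
    (𝔤 : Submodule ℚ (Module.End ℚ V)) (hbr : ∀ X ∈ 𝔤, ∀ X' ∈ 𝔤, X * X' - X' * X ∈ 𝔤) {Θ : Module.End ℂ (ℂ ⊗[ℚ] V)}
    (hΘ : ∀ p, ∀ x ∈ H.piece p (n - p), Θ x = ((2 * p - n : ℤ) : ℂ) • x) (hΘ𝔤 : Θ ∈ spanC 𝔤)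
    (hcomm : ∀ X ∈ 𝔤, ∀ a : H.endAlg, X * (a : Module.End ℚ V) = (a : Module.End ℚ V) * X)
    (hskew : ∀ X ∈ 𝔤, ∀ v w, ψ.form (X v) w + ψ.form v (X w) = 0) (i : ι) :
    ∃ N : Submodule ℂ (Module.End ℂ (ℂ ⊗[ℚ] V)), N ≤ spanC 𝔤 ∧
      (∀ W ∈ spanC 𝔤, ∀ Y ∈ N, W * Y - Y * W ∈ N) ∧
      (∀ W ∈ spanC 𝔤, ∃ Y ∈ N, ∀ x ∈ T i, W x = Y x) ∧
      (∀ Y ∈ N, (∀ x ∈ T i, Y x = 0) → Y = 0) ∧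
      (∀ m ∈ spanC 𝔤, (∀ x ∈ T i, m x = 0) → ∀ Y ∈ N, m * Y - Y * m = 0) := by
  classical
  letI : LieRing (Module.End ℂ (ℂ ⊗[ℚ] V)) := LieRing.ofAssociativeRing
  subst hn
  obtain ⟨𝔏, h𝔏⟩ := SpBlocksTheta.exists_lieSubalgebra_eq_spanC (V := V) 𝔤 hbr
  haveI := GluedSp.isSemisimple H rfl heff ψ T hint h4 hconj horth hTE hscal 𝔤 hbr hΘ hΘ𝔤 hcomm hskew 𝔏 h𝔏
  have hmem : ∀ Y : Module.End ℂ (ℂ ⊗[ℚ] V), Y ∈ spanC 𝔤 ↔ Y ∈ 𝔏 := fun Y => by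
    rw [← LieSubalgebra.mem_toSubmodule, h𝔏]
  have hYT : ∀ Y ∈ spanC 𝔤, ∀ x ∈ T i, Y x ∈ T i :=
    fun Y hY x hx => GluedSp.apply_mem_block H T hTE hcomm hY i hx
  have hbr' : ∀ W Y : 𝔏, ((⁅W, Y⁆ : 𝔏) : Module.End ℂ (ℂ ⊗[ℚ] V)) =
      (W : Module.End ℂ (ℂ ⊗[ℚ] V)) * (Y : Module.End ℂ (ℂ ⊗[ℚ] V)) -
        (Y : Module.End ℂ (ℂ ⊗[ℚ] V)) * (W : Module.End ℂ (ℂ ⊗[ℚ] V)) :=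
    fun W Y => by rw [LieSubalgebra.coe_bracket, LieRing.of_associative_ring_bracket]
  -- the ideal `M` of elements killing `T_i`, and a complementary ideal `N`
  obtain ⟨M, hmemM⟩ : ∃ M : LieIdeal ℂ 𝔏,
      ∀ Y : 𝔏, Y ∈ M ↔ ∀ x ∈ T i, (Y : Module.End ℂ (ℂ ⊗[ℚ] V)) x = 0 :=
    ⟨{ toSubmodule :=
          { carrier := {Y : 𝔏 | ∀ x ∈ T i, (Y : Module.End ℂ (ℂ ⊗[ℚ] V)) x = 0}
            zero_mem' := fun x _ => by simp
            add_mem' := fun {Y Y'} hY hY' x hx => by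
              rw [AddMemClass.coe_add, LinearMap.add_apply, hY x hx, hY' x hx, add_zero]
            smul_mem' := fun c {Y} hY x hx => by
              rw [SetLike.val_smul, LinearMap.smul_apply, hY x hx, smul_zero] },
        lie_mem := fun {W Y} hY x hx => by
          have hY' : ∀ x ∈ T i, (Y : Module.End ℂ (ℂ ⊗[ℚ] V)) x = 0 := hY
          rw [hbr', LinearMap.sub_apply, Module.End.mul_apply, Module.End.mul_apply, hY' x hx, map_zero,
            hY' _ (hYT _ ((hmem _).2 W.2) x hx), sub_zero] }, fun Y => Iff.rfl⟩
  obtain ⟨N, hc⟩ : ∃ N : LieIdeal ℂ 𝔏, IsCompl M N := ⟨Mᶜ, isCompl_compl⟩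
  have hinf : ∀ Y : 𝔏, Y ∈ M → Y ∈ N → Y = 0 := fun Y h1 h2 => by
    have h : Y ∈ M ⊓ N := (LieSubmodule.mem_inf M N Y).2 ⟨h1, h2⟩
    rwa [hc.inf_eq_bot, LieSubmodule.mem_bot] at h
  have hsup : ∀ Y : 𝔏, ∃ m ∈ M, ∃ nn ∈ N, m + nn = Y := fun Y => by
    have h : Y ∈ M ⊔ N := by rw [hc.sup_eq_top]; exact LieSubmodule.mem_top Y
    exact (LieSubmodule.mem_sup M N Y).1 h
  refine ⟨N.toSubmodule.map 𝔏.toSubmodule.subtype, ?_, ?_, ?_, ?_, ?_⟩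
  · rintro _ ⟨y, -, rfl⟩
    exact (hmem _).2 y.2
  · rintro W hW _ ⟨y, hy, rfl⟩
    exact ⟨⁅(⟨W, (hmem W).1 hW⟩ : 𝔏), y⁆, N.lie_mem hy, hbr' _ _⟩
  · intro W hW
    obtain ⟨m, hm, nn, hnn, hsum⟩ := hsup ⟨W, (hmem W).1 hW⟩
    refine ⟨nn, ⟨nn, hnn, rfl⟩, fun x hx => ?_⟩
    have h := congrArg (fun Y : 𝔏 => (Y : Module.End ℂ (ℂ ⊗[ℚ] V)) x) hsum
    simp only [AddMemClass.coe_add, LinearMap.add_apply] at h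
    rw [(hmemM m).1 hm x hx, zero_add] at h
    exact h.symm
  · rintro _ ⟨y, hy, rfl⟩ h0
    have h := hinf y ((hmemM y).2 h0) hy
    rw [h]
    exact ZeroMemClass.coe_zero 𝔏
  · rintro m hm hm0 _ ⟨y, hy, rfl⟩
    have hmM : (⟨m, (hmem m).1 hm⟩ : 𝔏) ∈ M := (hmemM _).2 hm0
    have h0 : ⁅(⟨m, (hmem m).1 hm⟩ : 𝔏), y⁆ = 0 :=
      hinf _ (by rw [← lie_skew]; exact M.neg_mem (M.lie_mem hmM)) (N.lie_mem hy)
    have h1 := congrArg (fun Y : 𝔏 => (Y : Module.End ℂ (ℂ ⊗[ℚ] V))) h0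
    simp only [hbr', ZeroMemClass.coe_zero] at h1
    exact h1

omit [HodgeTensorFacts.{u, u}] in
/-- **A `ℂ`-linear `F : T_i → T_j` between blocks of DIFFERENT classes intertwining the restrictions of every `X_ℂ`, `X ∈ 𝔤`,
vanishes**: its extension by zero commutes with `𝔤`, hence lies in `E_ℂ` by descent
(`ThetaSubalgebra.mem_span_endAlg_of_forall_commute`), so it carries `T_i` into the blocks of the class of `i` (`hsep`), which meet
`T_j` trivially. Hazama 1983 Lemma (3.1) / §3: blocks in different classes are non-isomorphic `𝔥`-modules.
[cite: Hazama1983, §3 (pp. 305–306)] [cite: MoonenZarhin1999LowDim, §2 (2.5) and §3 (3.1)] -/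
theorem GluedSp.eq_zero_of_equivariant (H : HodgeStructure V n) (T : ι → Submodule ℂ (ℂ ⊗[ℚ] V))
    (hint : DirectSum.IsInternal T)
    (hTE : ∀ Y : Module.End ℂ (ℂ ⊗[ℚ] V),
      (∀ a : H.endAlg, Y * (a : Module.End ℚ V).baseChange ℂ = (a : Module.End ℚ V).baseChange ℂ * Y) →
        ∀ p, Set.MapsTo Y (T p) (T p))
    (cls : ι → ι)
    (hsep : ∀ u ∈ Submodule.span ℂ ((fun a : Module.End ℚ V => a.baseChange ℂ) '' (H.endAlg : Set (Module.End ℚ V))),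
      ∀ p, ∀ x ∈ T p, u x ∈ ⨆ (p') (_ : cls p' = cls p), T p')
    (𝔤 : Submodule ℚ (Module.End ℚ V)) {Θ : Module.End ℂ (ℂ ⊗[ℚ] V)}
    (hΘ : ∀ p, ∀ x ∈ H.piece p (n - p), Θ x = ((2 * p - n : ℤ) : ℂ) • x) (hΘ𝔤 : Θ ∈ spanC 𝔤)
    (hcomm : ∀ X ∈ 𝔤, ∀ a : H.endAlg, X * (a : Module.End ℚ V) = (a : Module.End ℚ V) * X) {i j : ι}
    (hji : cls j ≠ cls i) (F : ↥(T i) →ₗ[ℂ] ↥(T j))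
    (hF : ∀ (X : Module.End ℚ V) (hX : X ∈ 𝔤) (x : T i),
      ((F ⟨X.baseChange ℂ x, GluedSp.apply_mem_block H T hTE hcomm (baseChange_mem_spanC hX) i x.2⟩ :
        T j) : ℂ ⊗[ℚ] V) = X.baseChange ℂ ((F x : T j) : ℂ ⊗[ℚ] V)) : F = 0 := by
  classical
  have hYT : ∀ X ∈ 𝔤, ∀ k, ∀ x ∈ T k, X.baseChange ℂ x ∈ T k :=
    fun X hX k x hx => GluedSp.apply_mem_block H T hTE hcomm (baseChange_mem_spanC hX) k hx
  have hcT := GluedSp.isCompl_block T hint i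
  obtain ⟨Zx, hZx_left, hZx_right⟩ : ∃ Zx : Module.End ℂ (ℂ ⊗[ℚ] V),
      (∀ x (hx : x ∈ T i), Zx x = F ⟨x, hx⟩) ∧ ∀ x ∈ (⨆ (k) (_ : k ≠ i), T k), Zx x = 0 :=
    ⟨(T j).subtype ∘ₗ F ∘ₗ (T i).projectionOnto _ hcT,
      fun x hx => by
        rw [LinearMap.comp_apply, LinearMap.comp_apply, Submodule.projectionOnto_apply_of_mem_left hcT hx, Submodule.coe_subtype],
      fun x hx => by
        rw [LinearMap.comp_apply, LinearMap.comp_apply, Submodule.projectionOnto_apply_of_mem_right hcT hx, map_zero, map_zero]⟩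
  have hc' : ∀ X ∈ 𝔤, Zx * X.baseChange ℂ = X.baseChange ℂ * Zx := by
    intro X hX
    refine LinearMap.ext fun v => ?_
    obtain ⟨a, ha, c, hcC, rfl⟩ := Submodule.mem_sup.1 (show v ∈ T i ⊔ (⨆ (k) (_ : k ≠ i), T k) by
      rw [hcT.sup_eq_top]; exact Submodule.mem_top)
    rw [Module.End.mul_apply, Module.End.mul_apply, map_add, map_add, map_add, map_add, hZx_right c hcC, map_zero, add_zero,
      hZx_right _ (GluedSp.mapsTo_iSup_ne T (fun k _ hx => hYT X hX k _ hx) i hcC), add_zero, hZx_left a ha,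
      hZx_left _ (hYT X hX i a ha)]
    exact hF X hX ⟨a, ha⟩
  have hZxE := ThetaSubalgebra.mem_span_endAlg_of_forall_commute H 𝔤 hΘ hΘ𝔤 hc'
  -- `T j` meets the class of `i` trivially
  have hle : (⨆ (p') (_ : cls p' = cls i), T p') ≤ ⨆ (k) (_ : k ≠ j), T k := by
    refine iSup₂_le fun p' hp' => GluedSp.le_iSup_ne T ?_
    rintro rfl
    exact hji hp'
  have hdisj : Disjoint (T j) (⨆ (k) (_ : k ≠ j), T k) := (GluedSp.isCompl_block T hint j).disjoint
  refine LinearMap.ext fun x => Subtype.ext ?_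
  rw [LinearMap.zero_apply, Submodule.coe_zero, ← hZx_left x.1 x.2]
  refine (Submodule.disjoint_def.1 hdisj) _ ?_ (hle (hsep _ hZxE i x.1 x.2))
  rw [hZx_left x.1 x.2]
  exact (F x).2

/-- **THE GOURSAT STEP for an admissible algebra (Moonen–Zarhin (3.1)/(3.4) for the rigid factor `𝔰𝔭(T_i)`).** In the
four-dimensional real-block situation, for every admissible `𝔤`, every block `T_i` and every `ψ_ℂ|_{T_i}`-skew `ℂ`-linear
`g : T_i → T_i` there is `Y ∈ 𝔤_ℂ` with `Y|_{T_i} = g` and `Y|_{T_j} = 0` for all `j ≠ i`. Proof as in the tree's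
`SymplecticBlocks.exists_mem_hodgeLieC_supported`: the ideal `N` complementary to `ker c_i` (§4) is supported on `T_i`, for
if it moved another block `T_j` then `c_j` would be injective on `N ≅ 𝔰𝔭(T_i)` and `ρ = c_j ∘ (c_i|_N)⁻¹` a bracket-preserving
injection `𝔰𝔭(T_i) → End(T_j)` intertwining `ad Θ`; the witness theorem `SymplecticWitness.exists_equivariant_ne_zero` (the
standard representation is the only length-one representation of `𝔰𝔭`) gives a non-zero equivariant `T_i → T_j`, which §4
forbids. [cite: MoonenZarhin1999LowDim, §3 (3.1) and Lemma (3.4)] [cite: MoonenZarhin1995Duke, Type I(2)]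
[cite: Hazama1983, §3 (pp. 305–306)] -/
theorem GluedSp.exists_mem_spanC_supported (H : HodgeStructure V n) (hn : n = 1) (heff : H.IsEffective)
    (ψ : H.Polarization)
    (T : ι → Submodule ℂ (ℂ ⊗[ℚ] V)) (hint : DirectSum.IsInternal T)
    (h4 : ∀ p, Module.finrank ℂ (T p) = 4) (hconj : ∀ p, ∀ x ∈ T p, conj x ∈ T p)
    (horth : ∀ p p', p ≠ p' → ∀ x ∈ T p, ∀ y ∈ T p', ψ.form.baseChange ℂ x y = 0)
    (hTE : ∀ Y : Module.End ℂ (ℂ ⊗[ℚ] V),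
      (∀ a : H.endAlg, Y * (a : Module.End ℚ V).baseChange ℂ = (a : Module.End ℚ V).baseChange ℂ * Y) →
        ∀ p, Set.MapsTo Y (T p) (T p))
    (hscal : ∀ u ∈ Submodule.span ℂ ((fun a : Module.End ℚ V => a.baseChange ℂ) '' (H.endAlg : Set (Module.End ℚ V))),
      (∀ p, Set.MapsTo u (T p) (T p)) → ∀ p, ∃ c : ℂ, ∀ x ∈ T p, u x = c • x)
    (cls : ι → ι)
    (hsep : ∀ u ∈ Submodule.span ℂ ((fun a : Module.End ℚ V => a.baseChange ℂ) '' (H.endAlg : Set (Module.End ℚ V))),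
      ∀ p, ∀ x ∈ T p, u x ∈ ⨆ (p') (_ : cls p' = cls p), T p')
    (𝔤 : Submodule ℚ (Module.End ℚ V)) (hbr : ∀ X ∈ 𝔤, ∀ X' ∈ 𝔤, X * X' - X' * X ∈ 𝔤) {Θ : Module.End ℂ (ℂ ⊗[ℚ] V)}
    (hΘ : ∀ p, ∀ x ∈ H.piece p (n - p), Θ x = ((2 * p - n : ℤ) : ℂ) • x) (hΘ𝔤 : Θ ∈ spanC 𝔤)
    (hcomm : ∀ X ∈ 𝔤, ∀ a : H.endAlg, X * (a : Module.End ℚ V) = (a : Module.End ℚ V) * X)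
    (hskew : ∀ X ∈ 𝔤, ∀ v w, ψ.form (X v) w + ψ.form v (X w) = 0) (i : ι) :
    ∀ g : Module.End ℂ ↥(T i),
      (∀ x y : T i, ψ.form.baseChange ℂ ((g x : T i) : ℂ ⊗[ℚ] V) y +
        ψ.form.baseChange ℂ (x : ℂ ⊗[ℚ] V) ((g y : T i) : ℂ ⊗[ℚ] V) = 0) →
      ∃ Y ∈ spanC 𝔤, (∀ x : T i, ((g x : T i) : ℂ ⊗[ℚ] V) = Y x) ∧
        ∀ j, cls j ≠ cls i → ∀ x ∈ T j, Y x = 0 := by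
  classical
  subst hn
  have hYT : ∀ Y ∈ spanC 𝔤, ∀ k, ∀ x ∈ T k, Y x ∈ T k :=
    fun Y hY k x hx => GluedSp.apply_mem_block H T hTE hcomm hY k hx
  have hYskew : ∀ Y ∈ spanC 𝔤, ∀ x y, ψ.form.baseChange ℂ (Y x) y + ψ.form.baseChange ℂ x (Y y) = 0 :=
    fun Y hY => ThetaSubalgebra.formBaseChange_add_eq_zero_of_mem_spanC ψ hskew hY
  obtain ⟨N', hN'le, hN'ideal, hN'dec, hN'uniq, hMN⟩ :=
    GluedSp.exists_complement_ideal H rfl heff ψ T hint h4 hconj horth hTE hscal 𝔤 hbr hΘ hΘ𝔤 hcomm hskew i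
  -- lifting a skew operator on `T_i` into `N'`
  have hliftN : ∀ g' : Module.End ℂ ↥(T i),
      (∀ x y : T i, ψ.form.baseChange ℂ ((g' x : T i) : ℂ ⊗[ℚ] V) y +
        ψ.form.baseChange ℂ (x : ℂ ⊗[ℚ] V) ((g' y : T i) : ℂ ⊗[ℚ] V) = 0) →
      ∃ Y ∈ N', ∀ x : T i, ((g' x : T i) : ℂ ⊗[ℚ] V) = Y x := by
    intro g' hg'
    obtain ⟨W, hW, hWg⟩ := GluedSp.exists_mem_spanC_restrict_eq H rfl heff ψ T hint h4 hconj horth hTE hscal 𝔤 hbr hΘ hΘ𝔤 hcomm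
      hskew i g' hg'
    obtain ⟨Y, hY, hWY⟩ := hN'dec W hW
    exact ⟨Y, hY, fun x => by rw [hWg x, hWY _ x.2]⟩
  have huniqN : ∀ Y Y', Y ∈ N' → Y' ∈ N' → (∀ x ∈ T i, Y x = Y' x) → Y = Y' :=
    fun Y Y' hY hY' h => sub_eq_zero.1 (hN'uniq _ (N'.sub_mem hY hY') fun x hx => by rw [LinearMap.sub_apply, h x hx, sub_self])
  intro g hg
  -- either `N'` is supported on `T_i` (done), or it moves some other block `T_j` (impossible)
  by_cases hsupp : ∀ j, cls j ≠ cls i → ∀ Y ∈ N', ∀ x ∈ T j, Y x = 0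
  · obtain ⟨Y, hY, hg'⟩ := hliftN g hg
    exact ⟨Y, hN'le hY, hg', fun j hj x hx => hsupp j hj Y hY x hx⟩
  exfalso
  push Not at hsupp
  obtain ⟨j, hji, Y₀, hY₀, x₀, hx₀, hY₀x₀⟩ := hsupp
  -- `N'` restricts onto `𝔰𝔭(T_j)`, `M` kills `T_j`, and `c_j` is injective on `N'`
  have hNonto := (GluedSp.restrict_ideal_dichotomy H rfl heff ψ T hint h4 hconj horth hTE hscal 𝔤 hbr hΘ hΘ𝔤 hcomm hskew N' hN'le
    hN'ideal j).resolve_left (fun h => hY₀x₀ (h Y₀ hY₀ x₀ hx₀))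
  have hMj : ∀ m ∈ spanC 𝔤, (∀ x ∈ T i, m x = 0) → ∀ x ∈ T j, m x = 0 :=
    fun m hm hm0 x hx => GluedSp.apply_eq_zero_of_forall_commute H rfl heff ψ T hint h4 hconj horth hTE 𝔤 hΘ hcomm hskew j N'
      hNonto hm (fun Y hY y _ => by
        have h := hMN m hm hm0 Y hY
        rw [← neg_sub, h, neg_zero, LinearMap.zero_apply]) hx
  have hinjN : ∀ Y ∈ N', (∀ x ∈ T j, Y x = 0) → Y = 0 := by
    -- the ideal `K = N' ∩ ker c_j`
    obtain ⟨K, hmemK⟩ : ∃ K : Submodule ℂ (Module.End ℂ (ℂ ⊗[ℚ] V)), ∀ Y, Y ∈ K ↔ Y ∈ N' ∧ ∀ x ∈ T j, Y x = 0 :=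
      ⟨{ carrier := {Y | Y ∈ N' ∧ ∀ x ∈ T j, Y x = 0}
         zero_mem' := ⟨N'.zero_mem, fun x _ => by simp⟩
         add_mem' := fun {Y Y'} hY hY' => ⟨N'.add_mem hY.1 hY'.1, fun x hx => by
           rw [LinearMap.add_apply, hY.2 x hx, hY'.2 x hx, add_zero]⟩
         smul_mem' := fun c {Y} hY => ⟨N'.smul_mem c hY.1, fun x hx => by rw [LinearMap.smul_apply, hY.2 x hx, smul_zero]⟩ },
        fun Y => Iff.rfl⟩
    have hKle : K ≤ spanC 𝔤 := fun Y hY => hN'le ((hmemK Y).1 hY).1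
    have hKideal : ∀ W ∈ spanC 𝔤, ∀ Y ∈ K, W * Y - Y * W ∈ K := fun W hW Y hY =>
      (hmemK _).2 ⟨hN'ideal W hW Y ((hmemK Y).1 hY).1, fun x hx => by
        rw [LinearMap.sub_apply, Module.End.mul_apply, Module.End.mul_apply, ((hmemK Y).1 hY).2 x hx, map_zero,
          ((hmemK Y).1 hY).2 _ (hYT W hW j x hx), sub_zero]⟩
    rcases GluedSp.restrict_ideal_dichotomy H rfl heff ψ T hint h4 hconj horth hTE hscal 𝔤 hbr hΘ hΘ𝔤 hcomm hskew K hKle hKideal i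
      with hK | hK
    · exact fun Y hY hYj => hN'uniq Y hY (hK Y ((hmemK Y).2 ⟨hY, hYj⟩))
    · exfalso
      apply hY₀x₀
      have hskew' : ∀ x y : T i,
          ψ.form.baseChange ℂ (((Y₀.restrict fun x hx => hYT _ (hN'le hY₀) i x hx) x : T i) : ℂ ⊗[ℚ] V) y +
            ψ.form.baseChange ℂ (x : ℂ ⊗[ℚ] V) (((Y₀.restrict fun x hx => hYT _ (hN'le hY₀) i x hx) y : T i) :
              ℂ ⊗[ℚ] V) = 0 := fun x y => by
        rw [LinearMap.coe_restrict_apply, LinearMap.coe_restrict_apply]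
        exact hYskew _ (hN'le hY₀) _ _
      obtain ⟨Yk, hYk, hYk'⟩ := hK _ hskew'
      have hyk : Y₀ = Yk := huniqN Y₀ Yk hY₀ ((hmemK Yk).1 hYk).1 fun x hx => by
        have h := hYk' ⟨x, hx⟩
        rwa [LinearMap.coe_restrict_apply] at h
      rw [hyk]
      exact ((hmemK Yk).1 hYk).2 x₀ hx₀
  -- block data on `T_i` and `T_j`
  obtain ⟨hωnd, hωalt, TΘ, P, Q, hTΘ, hTT, hTskew, hP, hQ, hPmem, hQmem, hP2, hQ2⟩ :=
    GluedSp.exists_blockData H rfl heff ψ T hint h4 hconj horth hTE hΘ i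
  obtain ⟨-, -, TΘj, -, -, hTΘj, hTTj, -⟩ := GluedSp.exists_blockData H rfl heff ψ T hint h4 hconj horth hTE hΘ j
  set ω : LinearMap.BilinForm ℂ ↥(T i) :=
    (ψ.form.baseChange ℂ).compl₁₂ (T i).subtype (T i).subtype with hω
  have hω_apply : ∀ x y : T i, ω x y = ψ.form.baseChange ℂ (x : ℂ ⊗[ℚ] V) y := fun x y => rfl
  clear_value ω
  have hP0 : P ≠ ⊥ := by
    intro h
    rw [h, finrank_bot] at hP2
    exact absurd hP2 (by norm_num)
  -- the skew operators on `T_i`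
  obtain ⟨𝔰, hmem𝔰⟩ : ∃ 𝔰 : Submodule ℂ (Module.End ℂ ↥(T i)),
      ∀ Z, Z ∈ 𝔰 ↔ ∀ x y : T i, ω (Z x) y + ω x (Z y) = 0 :=
    ⟨{ carrier := {Z | ∀ x y : T i, ω (Z x) y + ω x (Z y) = 0}
       zero_mem' := fun x y => by simp
       add_mem' := by
         intro Z Z' hZ hZ' x y
         simp only [LinearMap.add_apply, map_add]
         have h1 := hZ x y
         have h2 := hZ' x y
         linear_combination h1 + h2
       smul_mem' := by
         intro c Z hZ x y
         simp only [LinearMap.smul_apply, map_smul, smul_eq_mul]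
         have h1 := hZ x y
         linear_combination c * h1 }, fun Z => Iff.rfl⟩
  -- the lift `𝔰 → N'` and the transport `ρ : End(T_i) → End(T_j)`
  have hlift : ∀ Z : 𝔰, ∃ Y, Y ∈ N' ∧
      ∀ x : T i, ((((Z : Module.End ℂ ↥(T i)) x) : T i) : ℂ ⊗[ℚ] V) = Y x :=
    fun Z => hliftN Z fun x y => by rw [← hω_apply, ← hω_apply]; exact (hmem𝔰 _).1 Z.2 x y
  choose lift hliftN_mem hlift_eq using hlift
  have hlift_eq' : ∀ (Z : Module.End ℂ ↥(T i)) (hZ : Z ∈ 𝔰) (x : T i),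
      ((Z x : T i) : ℂ ⊗[ℚ] V) = lift ⟨Z, hZ⟩ x := fun Z hZ x => hlift_eq ⟨Z, hZ⟩ x
  have hlift_unique : ∀ (Z : 𝔰) (Y : Module.End ℂ (ℂ ⊗[ℚ] V)), Y ∈ N' →
      (∀ x : T i, ((((Z : Module.End ℂ ↥(T i)) x) : T i) : ℂ ⊗[ℚ] V) = Y x) →
      lift Z = Y :=
    fun Z Y hY h => huniqN _ _ (hliftN_mem Z) hY fun x hx => by rw [← hlift_eq Z ⟨x, hx⟩, h ⟨x, hx⟩]
  have hlift_add : ∀ Z Z' : 𝔰, lift (Z + Z') = lift Z + lift Z' :=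
    fun Z Z' => hlift_unique _ _ (N'.add_mem (hliftN_mem Z) (hliftN_mem Z')) fun x => by
      rw [Submodule.coe_add, LinearMap.add_apply, Submodule.coe_add, hlift_eq, hlift_eq, LinearMap.add_apply]
  have hlift_smul : ∀ (c : ℂ) (Z : 𝔰), lift (c • Z) = c • lift Z :=
    fun c Z => hlift_unique _ _ (N'.smul_mem c (hliftN_mem Z)) fun x => by
      rw [Submodule.coe_smul, LinearMap.smul_apply, Submodule.coe_smul, hlift_eq, LinearMap.smul_apply]
  have hliftTj : ∀ Z : 𝔰, ∀ x ∈ T j, lift Z x ∈ T j :=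
    fun Z x hx => hYT _ (hN'le (hliftN_mem Z)) j x hx
  obtain ⟨ρ₀, hρ₀⟩ : ∃ ρ₀ : 𝔰 →ₗ[ℂ] Module.End ℂ ↥(T j), ∀ (Z : 𝔰) (x : T j),
      ((ρ₀ Z x : T j) : ℂ ⊗[ℚ] V) = lift Z x :=
    ⟨{ toFun := fun Z => (lift Z).restrict (hliftTj Z)
       map_add' := fun Z Z' => LinearMap.ext fun x => Subtype.ext (by
         simp only [LinearMap.coe_restrict_apply, LinearMap.add_apply, hlift_add, Submodule.coe_add])
       map_smul' := fun c Z => LinearMap.ext fun x => Subtype.ext (by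
         simp only [LinearMap.coe_restrict_apply, LinearMap.smul_apply, hlift_smul, Submodule.coe_smul, RingHom.id_apply]) },
      fun Z x => rfl⟩
  obtain ⟨C, hC⟩ := Submodule.exists_isCompl (K := ℂ) (V := Module.End ℂ ↥(T i)) 𝔰
  obtain ⟨π𝔰, hπ𝔰⟩ : ∃ π𝔰 : Module.End ℂ ↥(T i) →ₗ[ℂ] ↥𝔰, ∀ Z (hZ : Z ∈ 𝔰), π𝔰 Z = ⟨Z, hZ⟩ :=
    ⟨Submodule.projectionOnto (R := ℂ) (E := Module.End ℂ ↥(T i)) 𝔰 C hC, fun Z hZ =>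
      Submodule.projectionOnto_apply_of_mem_left hC hZ⟩
  obtain ⟨ρ, hρ⟩ : ∃ ρ : Module.End ℂ ↥(T i) →ₗ[ℂ] Module.End ℂ ↥(T j),
      ∀ Z (hZ : Z ∈ 𝔰) (x : T j), ((ρ Z x : T j) : ℂ ⊗[ℚ] V) = lift ⟨Z, hZ⟩ x :=
    ⟨ρ₀ ∘ₗ π𝔰, fun Z hZ x => by rw [LinearMap.comp_apply, hπ𝔰 Z hZ, hρ₀]⟩
  -- `ρ` on the restriction of an element of `𝔤_ℂ`: it is the `T_j`-restriction of the same element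
  have hskew𝔰 : ∀ (W : Module.End ℂ (ℂ ⊗[ℚ] V)) (hW : W ∈ spanC 𝔤), W.restrict (fun x hx => hYT W hW i x hx) ∈ 𝔰 :=
    fun W hW => (hmem𝔰 _).2 fun x y => by
      rw [hω_apply, hω_apply, LinearMap.coe_restrict_apply, LinearMap.coe_restrict_apply]
      exact hYskew W hW _ _
  have hρ_restrict : ∀ (W : Module.End ℂ (ℂ ⊗[ℚ] V)) (hW : W ∈ spanC 𝔤) (x : T j),
      ((ρ (W.restrict fun x hx => hYT W hW i x hx) x : T j) : ℂ ⊗[ℚ] V) = W x := by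
    intro W hW x
    obtain ⟨Y, hY, hWY⟩ := hN'dec W hW
    have hl : lift ⟨_, hskew𝔰 W hW⟩ = Y := hlift_unique _ Y hY fun y => by rw [LinearMap.coe_restrict_apply, hWY _ y.2]
    have hWYj : ∀ y ∈ T j, (W - Y) y = 0 :=
      hMj (W - Y) (Submodule.sub_mem _ hW (hN'le hY)) fun y hy => by rw [LinearMap.sub_apply, hWY y hy, sub_self]
    have h := hWYj x x.2
    rw [LinearMap.sub_apply, sub_eq_zero] at h
    rw [hρ _ (hskew𝔰 W hW), hl, h]
  -- hypotheses of the witness theorem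
  have hρbr : ∀ Z ∈ 𝔰, ∀ Z' ∈ 𝔰, ρ (Z * Z' - Z' * Z) = ρ Z * ρ Z' - ρ Z' * ρ Z := by
    intro Z hZ Z' hZ'
    have h𝔰br : Z * Z' - Z' * Z ∈ 𝔰 := (hmem𝔰 _).2 fun x y => by
      simp only [LinearMap.sub_apply, Module.End.mul_apply, map_sub, LinearMap.sub_apply]
      have h1 := (hmem𝔰 Z).1 hZ (Z' x) y
      have h2 := (hmem𝔰 Z').1 hZ' x (Z y)
      have h3 := (hmem𝔰 Z').1 hZ' (Z x) y
      have h4 := (hmem𝔰 Z).1 hZ x (Z' y)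
      linear_combination h1 - h3 + h4 - h2
    have hl : lift ⟨_, h𝔰br⟩ = lift ⟨Z, hZ⟩ * lift ⟨Z', hZ'⟩ - lift ⟨Z', hZ'⟩ * lift ⟨Z, hZ⟩ :=
      hlift_unique _ _ (hN'ideal _ (hN'le (hliftN_mem _)) _ (hliftN_mem _)) fun x => by
        change (((Z * Z' - Z' * Z) x : T i) : ℂ ⊗[ℚ] V) = _
        rw [LinearMap.sub_apply, Submodule.coe_sub, Module.End.mul_apply, Module.End.mul_apply, hlift_eq' Z hZ, hlift_eq' Z' hZ',
          hlift_eq' Z' hZ', hlift_eq' Z hZ, LinearMap.sub_apply, Module.End.mul_apply, Module.End.mul_apply]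
    refine LinearMap.ext fun x => Subtype.ext ?_
    rw [hρ _ h𝔰br, hl]
    simp only [LinearMap.sub_apply, Submodule.coe_sub, Module.End.mul_apply, hρ _ hZ, hρ _ hZ']
  have hTΘ𝔰 : TΘ ∈ 𝔰 := (hmem𝔰 _).2 hTskew
  have hρTΘ : ρ TΘ = TΘj := by
    have h := hρ_restrict Θ hΘ𝔤
    have hres : Θ.restrict (fun x hx => hYT Θ hΘ𝔤 i x hx) = TΘ :=
      LinearMap.ext fun x => Subtype.ext (by rw [LinearMap.coe_restrict_apply, hTΘ])
    rw [hres] at h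
    exact LinearMap.ext fun x => Subtype.ext (by rw [h, hTΘj])
  have hρΘ : ∀ Z ∈ 𝔰, ρ (TΘ * Z - Z * TΘ) = TΘj * ρ Z - ρ Z * TΘj := fun Z hZ => by
    rw [hρbr TΘ hTΘ𝔰 Z hZ, hρTΘ]
  have hinjρ : ∀ Z ∈ 𝔰, ρ Z = 0 → Z = 0 := by
    intro Z hZ h0
    have hl0 : lift ⟨Z, hZ⟩ = 0 := hinjN _ (hliftN_mem _) fun x hx => by
      have h := congrArg (fun f : Module.End ℂ ↥(T j) => ((f ⟨x, hx⟩ : T j) : ℂ ⊗[ℚ] V)) h0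
      simp only [LinearMap.zero_apply, Submodule.coe_zero] at h
      rw [← h, hρ _ hZ]
    refine LinearMap.ext fun x => Subtype.ext ?_
    rw [hlift_eq' Z hZ, hl0, LinearMap.zero_apply, LinearMap.zero_apply, Submodule.coe_zero]
  -- the witness: a non-zero `ρ`-equivariant `F : T_i → T_j` — which must vanish
  obtain ⟨F, hF0, hF⟩ := SymplecticWitness.exists_equivariant_ne_zero ω hωnd hωalt hTT hTskew hP hQ hPmem hQmem hP0 𝔰 hmem𝔰 hTTj ρ
    hρbr hρΘ hinjρ
  refine hF0 (GluedSp.eq_zero_of_equivariant H T hint hTE cls hsep 𝔤 hΘ hΘ𝔤 hcomm hji F fun X hX x => ?_)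
  have hW : X.baseChange ℂ ∈ spanC 𝔤 := baseChange_mem_spanC hX
  have h := congrArg (fun f : ↥(T i) →ₗ[ℂ] ↥(T j) => ((f x : T j) : ℂ ⊗[ℚ] V))
    (hF _ (hskew𝔰 _ hW))
  simp only [LinearMap.comp_apply] at h
  rw [hρ_restrict _ hW] at h
  exact h.symm


/-! ### §5 With links: `𝔤_ℂ = 𝔰𝔭_E(V, ψ)_ℂ = ⊕_{classes} 𝔰𝔭₄` glued along the links, `𝔤 = Lie Hg(H)`, Theorem L -/

section Links

variable [Fintype ι]

omit [Module.Finite ℚ V] [HodgeTensorFacts.{u, u}] [DecidableEq ι] [Fintype ι] in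
/-- An operator commuting with every `a ⊗ 1`, `a ∈ E`, commutes with all of `E_ℂ` (the commutant of `E_ℂ` is that of the
`a ⊗ 1`). [cite: Deligne1982HodgeCycles, I §3 Prop. 3.4] -/
theorem GluedSp.commute_of_mem_span_endAlg (H : HodgeStructure V n) {Y : Module.End ℂ (ℂ ⊗[ℚ] V)}
    (hYE : ∀ a : H.endAlg, Y * (a : Module.End ℚ V).baseChange ℂ = (a : Module.End ℚ V).baseChange ℂ * Y)
    {u : Module.End ℂ (ℂ ⊗[ℚ] V)}
    (hu : u ∈ Submodule.span ℂ ((fun a : Module.End ℚ V => a.baseChange ℂ) '' (H.endAlg : Set (Module.End ℚ V)))) :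
    Y * u = u * Y := by
  induction hu using Submodule.span_induction with
  | mem Z hZ =>
    obtain ⟨a, ha, rfl⟩ := hZ
    exact hYE ⟨a, ha⟩
  | zero => rw [mul_zero, zero_mul]
  | add Z Z' _ _ hZ hZ' => rw [mul_add, add_mul, hZ, hZ']
  | smul c Z _ hZ => rw [mul_smul_comm, smul_mul_assoc, hZ]

/-- **`𝔤_ℂ ⊇ 𝔰𝔭_E(V, ψ)_ℂ`: every `ψ_ℂ`-skew operator commuting with `E_ℂ` lies in `𝔤_ℂ`** (four-dimensional real blocks
glued along the classes; every admissible `𝔤`). Such a `Y` preserves the blocks; on the representative block `T_{cls q}` of each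
class it has a supported lift `Y_{cls q} ∈ 𝔤_ℂ` (§4), and `Y = ∑_{classes} Y_{cls q}`: both sides commute with the link
`L ∈ E_ℂ` carrying `T_{cls q}` onto `T_q` and agree on `T_{cls q}`. With the converse (§0) this is
`𝔤_ℂ = 𝔰𝔭_E(V, ψ)_ℂ = ⊕_{classes} 𝔰𝔭₄` — Moonen–Zarhin 1995, Type II: «`Hg(X) = Sp_D(V, φ)`»; Hazama §3: «the i-th component acts
on `V_i ⊕ ⋯ ⊕ V_i` diagonally»; for EVERY admissible rational algebra (Deligne's minimality).
[cite: MoonenZarhin1995Duke, Type II] [cite: Hazama1983, §3 (pp. 305–306)] [cite: Deligne1982HodgeCycles, I §3 Prop. 3.4] -/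
theorem GluedSp.mem_spanC_of_commute_of_skew (H : HodgeStructure V n) (hn : n = 1) (heff : H.IsEffective)
    (ψ : H.Polarization) (T : ι → Submodule ℂ (ℂ ⊗[ℚ] V)) (hint : DirectSum.IsInternal T)
    (h4 : ∀ p, Module.finrank ℂ (T p) = 4) (hconj : ∀ p, ∀ x ∈ T p, conj x ∈ T p)
    (horth : ∀ p p', p ≠ p' → ∀ x ∈ T p, ∀ y ∈ T p', ψ.form.baseChange ℂ x y = 0)
    (hTE : ∀ Y : Module.End ℂ (ℂ ⊗[ℚ] V),
      (∀ a : H.endAlg, Y * (a : Module.End ℚ V).baseChange ℂ = (a : Module.End ℚ V).baseChange ℂ * Y) →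
        ∀ p, Set.MapsTo Y (T p) (T p))
    (hscal : ∀ u ∈ Submodule.span ℂ ((fun a : Module.End ℚ V => a.baseChange ℂ) '' (H.endAlg : Set (Module.End ℚ V))),
      (∀ p, Set.MapsTo u (T p) (T p)) → ∀ p, ∃ c : ℂ, ∀ x ∈ T p, u x = c • x)
    (cls : ι → ι) (hcls : ∀ p, cls (cls p) = cls p)
    (hsep : ∀ u ∈ Submodule.span ℂ ((fun a : Module.End ℚ V => a.baseChange ℂ) '' (H.endAlg : Set (Module.End ℚ V))),
      ∀ p, ∀ x ∈ T p, u x ∈ ⨆ (p') (_ : cls p' = cls p), T p')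
    (hlink : ∀ p, ∃ L ∈ Submodule.span ℂ ((fun a : Module.End ℚ V => a.baseChange ℂ) '' (H.endAlg : Set (Module.End ℚ V))),
      ∃ L' : Module.End ℂ (ℂ ⊗[ℚ] V), (∀ x ∈ T p, L' x ∈ T (cls p)) ∧ ∀ x ∈ T p, L (L' x) = x)
    (𝔤 : Submodule ℚ (Module.End ℚ V)) (hbr : ∀ X ∈ 𝔤, ∀ X' ∈ 𝔤, X * X' - X' * X ∈ 𝔤) {Θ : Module.End ℂ (ℂ ⊗[ℚ] V)}
    (hΘ : ∀ p, ∀ x ∈ H.piece p (n - p), Θ x = ((2 * p - n : ℤ) : ℂ) • x) (hΘ𝔤 : Θ ∈ spanC 𝔤)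
    (hcomm : ∀ X ∈ 𝔤, ∀ a : H.endAlg, X * (a : Module.End ℚ V) = (a : Module.End ℚ V) * X)
    (hskew : ∀ X ∈ 𝔤, ∀ v w, ψ.form (X v) w + ψ.form v (X w) = 0) {Y : Module.End ℂ (ℂ ⊗[ℚ] V)}
    (hYE : ∀ a : H.endAlg, Y * (a : Module.End ℚ V).baseChange ℂ = (a : Module.End ℚ V).baseChange ℂ * Y)
    (hYskew : ∀ x y, ψ.form.baseChange ℂ (Y x) y + ψ.form.baseChange ℂ x (Y y) = 0) : Y ∈ spanC 𝔤 := by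
  classical
  have hYT : ∀ k, Set.MapsTo Y (T k) (T k) := hTE Y hYE
  have hsk : ∀ p, ∀ x y : T p,
      ψ.form.baseChange ℂ (((Y.restrict fun x hx => hYT p hx) x : T p) : ℂ ⊗[ℚ] V) y +
        ψ.form.baseChange ℂ (x : ℂ ⊗[ℚ] V) (((Y.restrict fun x hx => hYT p hx) y : T p) : ℂ ⊗[ℚ] V) = 0 :=
    fun p x y => by rw [LinearMap.coe_restrict_apply, LinearMap.coe_restrict_apply]; exact hYskew _ _
  choose L hLmem hLeq hLzero using fun p =>
    GluedSp.exists_mem_spanC_supported H hn heff ψ T hint h4 hconj horth hTE hscal cls hsep 𝔤 hbr hΘ hΘ𝔤 hcomm hskew p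
      (Y.restrict fun x hx => hYT p hx) (hsk p)
  -- on every block, `Y` agrees with the lift from the representative block of its class
  have hagree : ∀ q, ∀ x ∈ T q, Y x = L (cls q) x := by
    intro q x hx
    obtain ⟨L₀, hL₀, L₀', hL₀'T, hLL'⟩ := hlink q
    have hYL₀ : Y * L₀ = L₀ * Y := GluedSp.commute_of_mem_span_endAlg H hYE hL₀
    have hLL₀ : L (cls q) * L₀ = L₀ * L (cls q) :=
      GluedSp.commute_of_mem_span_endAlg H (GluedSp.commute_baseChange_of_mem_spanC H hcomm (hLmem (cls q))) hL₀
    have hy : L₀' x ∈ T (cls q) := hL₀'T x hx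
    have h1 : Y (L₀' x) = L (cls q) (L₀' x) := by
      have h := hLeq (cls q) ⟨L₀' x, hy⟩
      rw [LinearMap.coe_restrict_apply] at h
      exact h
    calc Y x = Y (L₀ (L₀' x)) := by rw [hLL' x hx]
      _ = L₀ (Y (L₀' x)) := by rw [← Module.End.mul_apply, hYL₀, Module.End.mul_apply]
      _ = L₀ (L (cls q) (L₀' x)) := by rw [h1]
      _ = L (cls q) (L₀ (L₀' x)) := by rw [← Module.End.mul_apply, ← hLL₀, Module.End.mul_apply]
      _ = L (cls q) x := by rw [hLL' x hx]
  -- `Y` is the sum of the lifts over the classes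
  set S : Finset ι := Finset.univ.image cls with hS
  have hsum : Y = ∑ r ∈ S, L r := by
    refine LinearMap.ext fun v => ?_
    have hv : v ∈ ⨆ j, T j := by
      rw [hint.submodule_iSup_eq_top]
      exact Submodule.mem_top
    induction hv using Submodule.iSup_induction' with
    | mem q x hx =>
      have hq : cls q ∈ S := Finset.mem_image_of_mem cls (Finset.mem_univ q)
      rw [LinearMap.sum_apply, Finset.sum_eq_single (cls q) (fun r hr hrq => ?_) (fun h => absurd hq h), hagree q x hx]
      obtain ⟨r', -, rfl⟩ := Finset.mem_image.1 hr
      exact hLzero (cls r') q (by rw [hcls]; exact Ne.symm hrq) x hx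
    | zero => simp
    | add x y _ _ hx hy => rw [map_add, map_add, hx, hy]
  rw [hsum]
  exact Submodule.sum_mem _ fun r _ => hLmem r

/-- **`𝔤_ℂ = 𝔰𝔭_E(V, ψ)_ℂ`**: `Y ∈ 𝔤_ℂ` iff `Y` commutes with `E_ℂ` and is `ψ_ℂ`-skew (glued four-dimensional real blocks, every
admissible `𝔤`). [cite: MoonenZarhin1995Duke, Type II] [cite: Hazama1983, §3 (pp. 305–306)] -/
theorem GluedSp.mem_spanC_iff_commute_and_skew (H : HodgeStructure V n) (hn : n = 1) (heff : H.IsEffective)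
    (ψ : H.Polarization) (T : ι → Submodule ℂ (ℂ ⊗[ℚ] V)) (hint : DirectSum.IsInternal T)
    (h4 : ∀ p, Module.finrank ℂ (T p) = 4) (hconj : ∀ p, ∀ x ∈ T p, conj x ∈ T p)
    (horth : ∀ p p', p ≠ p' → ∀ x ∈ T p, ∀ y ∈ T p', ψ.form.baseChange ℂ x y = 0)
    (hTE : ∀ Y : Module.End ℂ (ℂ ⊗[ℚ] V),
      (∀ a : H.endAlg, Y * (a : Module.End ℚ V).baseChange ℂ = (a : Module.End ℚ V).baseChange ℂ * Y) →
        ∀ p, Set.MapsTo Y (T p) (T p))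
    (hscal : ∀ u ∈ Submodule.span ℂ ((fun a : Module.End ℚ V => a.baseChange ℂ) '' (H.endAlg : Set (Module.End ℚ V))),
      (∀ p, Set.MapsTo u (T p) (T p)) → ∀ p, ∃ c : ℂ, ∀ x ∈ T p, u x = c • x)
    (cls : ι → ι) (hcls : ∀ p, cls (cls p) = cls p)
    (hsep : ∀ u ∈ Submodule.span ℂ ((fun a : Module.End ℚ V => a.baseChange ℂ) '' (H.endAlg : Set (Module.End ℚ V))),
      ∀ p, ∀ x ∈ T p, u x ∈ ⨆ (p') (_ : cls p' = cls p), T p')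
    (hlink : ∀ p, ∃ L ∈ Submodule.span ℂ ((fun a : Module.End ℚ V => a.baseChange ℂ) '' (H.endAlg : Set (Module.End ℚ V))),
      ∃ L' : Module.End ℂ (ℂ ⊗[ℚ] V), (∀ x ∈ T p, L' x ∈ T (cls p)) ∧ ∀ x ∈ T p, L (L' x) = x)
    (𝔤 : Submodule ℚ (Module.End ℚ V)) (hbr : ∀ X ∈ 𝔤, ∀ X' ∈ 𝔤, X * X' - X' * X ∈ 𝔤) {Θ : Module.End ℂ (ℂ ⊗[ℚ] V)}
    (hΘ : ∀ p, ∀ x ∈ H.piece p (n - p), Θ x = ((2 * p - n : ℤ) : ℂ) • x) (hΘ𝔤 : Θ ∈ spanC 𝔤)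
    (hcomm : ∀ X ∈ 𝔤, ∀ a : H.endAlg, X * (a : Module.End ℚ V) = (a : Module.End ℚ V) * X)
    (hskew : ∀ X ∈ 𝔤, ∀ v w, ψ.form (X v) w + ψ.form v (X w) = 0) (Y : Module.End ℂ (ℂ ⊗[ℚ] V)) :
    Y ∈ spanC 𝔤 ↔
      (∀ a : H.endAlg, Y * (a : Module.End ℚ V).baseChange ℂ = (a : Module.End ℚ V).baseChange ℂ * Y) ∧
      (∀ x y, ψ.form.baseChange ℂ (Y x) y + ψ.form.baseChange ℂ x (Y y) = 0) :=
  ⟨fun hY => ⟨GluedSp.commute_baseChange_of_mem_spanC H hcomm hY,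
      ThetaSubalgebra.formBaseChange_add_eq_zero_of_mem_spanC ψ hskew hY⟩,
    fun ⟨hE, hs⟩ => GluedSp.mem_spanC_of_commute_of_skew H hn heff ψ T hint h4 hconj horth hTE hscal cls hcls hsep hlink 𝔤 hbr
      hΘ hΘ𝔤 hcomm hskew hE hs⟩

/-- **`𝔤 = 𝔰𝔭_E(V, ψ)`, rational form**: a rational `X` lies in `𝔤` iff it commutes with every Hodge endomorphism and is
`ψ`-skew (descent `X ∈ 𝔤 ↔ X_ℂ ∈ 𝔤_ℂ`). [cite: MoonenZarhin1995Duke, Type II] [cite: Deligne1982HodgeCycles, I §3 Prop. 3.4] -/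
theorem GluedSp.mem_iff_commute_and_skew (H : HodgeStructure V n) (hn : n = 1) (heff : H.IsEffective)
    (ψ : H.Polarization) (T : ι → Submodule ℂ (ℂ ⊗[ℚ] V)) (hint : DirectSum.IsInternal T)
    (h4 : ∀ p, Module.finrank ℂ (T p) = 4) (hconj : ∀ p, ∀ x ∈ T p, conj x ∈ T p)
    (horth : ∀ p p', p ≠ p' → ∀ x ∈ T p, ∀ y ∈ T p', ψ.form.baseChange ℂ x y = 0)
    (hTE : ∀ Y : Module.End ℂ (ℂ ⊗[ℚ] V),
      (∀ a : H.endAlg, Y * (a : Module.End ℚ V).baseChange ℂ = (a : Module.End ℚ V).baseChange ℂ * Y) →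
        ∀ p, Set.MapsTo Y (T p) (T p))
    (hscal : ∀ u ∈ Submodule.span ℂ ((fun a : Module.End ℚ V => a.baseChange ℂ) '' (H.endAlg : Set (Module.End ℚ V))),
      (∀ p, Set.MapsTo u (T p) (T p)) → ∀ p, ∃ c : ℂ, ∀ x ∈ T p, u x = c • x)
    (cls : ι → ι) (hcls : ∀ p, cls (cls p) = cls p)
    (hsep : ∀ u ∈ Submodule.span ℂ ((fun a : Module.End ℚ V => a.baseChange ℂ) '' (H.endAlg : Set (Module.End ℚ V))),
      ∀ p, ∀ x ∈ T p, u x ∈ ⨆ (p') (_ : cls p' = cls p), T p')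
    (hlink : ∀ p, ∃ L ∈ Submodule.span ℂ ((fun a : Module.End ℚ V => a.baseChange ℂ) '' (H.endAlg : Set (Module.End ℚ V))),
      ∃ L' : Module.End ℂ (ℂ ⊗[ℚ] V), (∀ x ∈ T p, L' x ∈ T (cls p)) ∧ ∀ x ∈ T p, L (L' x) = x)
    (𝔤 : Submodule ℚ (Module.End ℚ V)) (hbr : ∀ X ∈ 𝔤, ∀ X' ∈ 𝔤, X * X' - X' * X ∈ 𝔤) {Θ : Module.End ℂ (ℂ ⊗[ℚ] V)}
    (hΘ : ∀ p, ∀ x ∈ H.piece p (n - p), Θ x = ((2 * p - n : ℤ) : ℂ) • x) (hΘ𝔤 : Θ ∈ spanC 𝔤)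
    (hcomm : ∀ X ∈ 𝔤, ∀ a : H.endAlg, X * (a : Module.End ℚ V) = (a : Module.End ℚ V) * X)
    (hskew : ∀ X ∈ 𝔤, ∀ v w, ψ.form (X v) w + ψ.form v (X w) = 0) (X : Module.End ℚ V) :
    X ∈ 𝔤 ↔
      (∀ a : H.endAlg, X * (a : Module.End ℚ V) = (a : Module.End ℚ V) * X) ∧
      (∀ v w, ψ.form (X v) w + ψ.form v (X w) = 0) := by
  refine ⟨fun hX => ⟨hcomm X hX, hskew X hX⟩, fun ⟨hc, hs⟩ => ?_⟩
  rw [mem_iff_baseChange_mem_spanC]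
  exact GluedSp.mem_spanC_of_commute_of_skew H hn heff ψ T hint h4 hconj horth hTE hscal cls hcls hsep hlink 𝔤 hbr hΘ hΘ𝔤
    hcomm hskew (fun a => by rw [← LinearMap.baseChange_mul, hc a, LinearMap.baseChange_mul])
    (ThetaSubalgebra.formBaseChange_add_eq_zero_of_skew ψ hs)

/-- **UNIQUENESS: `𝔤 = Lie Hg(H)`** — the Lie algebra of the Hodge group is the ONLY rational bracket-closed subspace of
`𝔰𝔭_E(V, ψ)` whose complexification contains the Hodge operator, in the glued four-dimensional real-block situation (both are
`𝔰𝔭_E(V, ψ)`: `Lie Hg` itself is admissible). Deligne's minimality (LNM 900 I Prop. 3.4) in Lie form; for `H = H¹(X)`, `X` a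
simple abelian fourfold of Type II: «`Hg(X) = Sp_D(V, φ)`» (Moonen–Zarhin 1995).
[cite: Deligne1982HodgeCycles, I §3 Prop. 3.4] [cite: MoonenZarhin1995Duke, Type II] -/
theorem GluedSp.eq_hodgeLie (H : HodgeStructure V n) (hn : n = 1) (heff : H.IsEffective)
    (ψ : H.Polarization) (T : ι → Submodule ℂ (ℂ ⊗[ℚ] V)) (hint : DirectSum.IsInternal T)
    (h4 : ∀ p, Module.finrank ℂ (T p) = 4) (hconj : ∀ p, ∀ x ∈ T p, conj x ∈ T p)
    (horth : ∀ p p', p ≠ p' → ∀ x ∈ T p, ∀ y ∈ T p', ψ.form.baseChange ℂ x y = 0)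
    (hTE : ∀ Y : Module.End ℂ (ℂ ⊗[ℚ] V),
      (∀ a : H.endAlg, Y * (a : Module.End ℚ V).baseChange ℂ = (a : Module.End ℚ V).baseChange ℂ * Y) →
        ∀ p, Set.MapsTo Y (T p) (T p))
    (hscal : ∀ u ∈ Submodule.span ℂ ((fun a : Module.End ℚ V => a.baseChange ℂ) '' (H.endAlg : Set (Module.End ℚ V))),
      (∀ p, Set.MapsTo u (T p) (T p)) → ∀ p, ∃ c : ℂ, ∀ x ∈ T p, u x = c • x)
    (cls : ι → ι) (hcls : ∀ p, cls (cls p) = cls p)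
    (hsep : ∀ u ∈ Submodule.span ℂ ((fun a : Module.End ℚ V => a.baseChange ℂ) '' (H.endAlg : Set (Module.End ℚ V))),
      ∀ p, ∀ x ∈ T p, u x ∈ ⨆ (p') (_ : cls p' = cls p), T p')
    (hlink : ∀ p, ∃ L ∈ Submodule.span ℂ ((fun a : Module.End ℚ V => a.baseChange ℂ) '' (H.endAlg : Set (Module.End ℚ V))),
      ∃ L' : Module.End ℂ (ℂ ⊗[ℚ] V), (∀ x ∈ T p, L' x ∈ T (cls p)) ∧ ∀ x ∈ T p, L (L' x) = x)
    (𝔤 : Submodule ℚ (Module.End ℚ V)) (hbr : ∀ X ∈ 𝔤, ∀ X' ∈ 𝔤, X * X' - X' * X ∈ 𝔤) {Θ : Module.End ℂ (ℂ ⊗[ℚ] V)}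
    (hΘ : ∀ p, ∀ x ∈ H.piece p (n - p), Θ x = ((2 * p - n : ℤ) : ℂ) • x) (hΘ𝔤 : Θ ∈ spanC 𝔤)
    (hcomm : ∀ X ∈ 𝔤, ∀ a : H.endAlg, X * (a : Module.End ℚ V) = (a : Module.End ℚ V) * X)
    (hskew : ∀ X ∈ 𝔤, ∀ v w, ψ.form (X v) w + ψ.form v (X w) = 0) : 𝔤 = H.hodgeLie := by
  have hΘh : Θ ∈ spanC H.hodgeLie := by
    rw [← hodgeLieC_eq_spanC]
    exact H.mem_hodgeLieC_of_forall_piece hΘ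
  ext X
  rw [GluedSp.mem_iff_commute_and_skew H hn heff ψ T hint h4 hconj horth hTE hscal cls hcls hsep hlink 𝔤 hbr hΘ hΘ𝔤 hcomm hskew,
    GluedSp.mem_iff_commute_and_skew H hn heff ψ T hint h4 hconj horth hTE hscal cls hcls hsep hlink H.hodgeLie
      (fun X hX X' hX' => H.commutator_mem_hodgeLie hX hX') hΘ hΘh (fun X hX a => H.commute_of_mem_hodgeLie hX a)
      (fun X hX v w => form_apply_add_eq_zero_of_mem_hodgeLie ψ hX v w)]

/-- **`𝔤_ℂ = Lie Hg(H) ⊗ ℂ`.** [cite: Deligne1982HodgeCycles, I §3 Prop. 3.4] [cite: MoonenZarhin1995Duke, Type II] -/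
theorem GluedSp.spanC_eq_hodgeLieC (H : HodgeStructure V n) (hn : n = 1) (heff : H.IsEffective)
    (ψ : H.Polarization) (T : ι → Submodule ℂ (ℂ ⊗[ℚ] V)) (hint : DirectSum.IsInternal T)
    (h4 : ∀ p, Module.finrank ℂ (T p) = 4) (hconj : ∀ p, ∀ x ∈ T p, conj x ∈ T p)
    (horth : ∀ p p', p ≠ p' → ∀ x ∈ T p, ∀ y ∈ T p', ψ.form.baseChange ℂ x y = 0)
    (hTE : ∀ Y : Module.End ℂ (ℂ ⊗[ℚ] V),
      (∀ a : H.endAlg, Y * (a : Module.End ℚ V).baseChange ℂ = (a : Module.End ℚ V).baseChange ℂ * Y) →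
        ∀ p, Set.MapsTo Y (T p) (T p))
    (hscal : ∀ u ∈ Submodule.span ℂ ((fun a : Module.End ℚ V => a.baseChange ℂ) '' (H.endAlg : Set (Module.End ℚ V))),
      (∀ p, Set.MapsTo u (T p) (T p)) → ∀ p, ∃ c : ℂ, ∀ x ∈ T p, u x = c • x)
    (cls : ι → ι) (hcls : ∀ p, cls (cls p) = cls p)
    (hsep : ∀ u ∈ Submodule.span ℂ ((fun a : Module.End ℚ V => a.baseChange ℂ) '' (H.endAlg : Set (Module.End ℚ V))),
      ∀ p, ∀ x ∈ T p, u x ∈ ⨆ (p') (_ : cls p' = cls p), T p')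
    (hlink : ∀ p, ∃ L ∈ Submodule.span ℂ ((fun a : Module.End ℚ V => a.baseChange ℂ) '' (H.endAlg : Set (Module.End ℚ V))),
      ∃ L' : Module.End ℂ (ℂ ⊗[ℚ] V), (∀ x ∈ T p, L' x ∈ T (cls p)) ∧ ∀ x ∈ T p, L (L' x) = x)
    (𝔤 : Submodule ℚ (Module.End ℚ V)) (hbr : ∀ X ∈ 𝔤, ∀ X' ∈ 𝔤, X * X' - X' * X ∈ 𝔤) {Θ : Module.End ℂ (ℂ ⊗[ℚ] V)}
    (hΘ : ∀ p, ∀ x ∈ H.piece p (n - p), Θ x = ((2 * p - n : ℤ) : ℂ) • x) (hΘ𝔤 : Θ ∈ spanC 𝔤)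
    (hcomm : ∀ X ∈ 𝔤, ∀ a : H.endAlg, X * (a : Module.End ℚ V) = (a : Module.End ℚ V) * X)
    (hskew : ∀ X ∈ 𝔤, ∀ v w, ψ.form (X v) w + ψ.form v (X w) = 0) : spanC 𝔤 = H.hodgeLieC := by
  rw [GluedSp.eq_hodgeLie H hn heff ψ T hint h4 hconj horth hTE hscal cls hcls hsep hlink 𝔤 hbr hΘ hΘ𝔤 hcomm hskew,
    hodgeLieC_eq_spanC]

/-- **`Lie Hg(H) ⊗ ℂ = 𝔰𝔭_E(V, ψ)_ℂ`** (glued four-dimensional real blocks): `Y ∈ Lie Hg ⊗ ℂ` iff `Y` commutes with `E_ℂ` and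
is `ψ_ℂ`-skew. Moonen–Zarhin 1995, Type II «`Hg(X) = Sp_D(V, φ)`»; Milne 1999 §2 / Abdulali §2.4: over `k^al` the Lefschetz
group of type II acts on each place through `Sp` in two copies of its standard representation.
[cite: MoonenZarhin1995Duke, Type II] [cite: Abdulali2016TateTwists, §2.4] -/
theorem GluedSp.mem_hodgeLieC_iff_commute_and_skew (H : HodgeStructure V n) (hn : n = 1) (heff : H.IsEffective)
    (ψ : H.Polarization) (T : ι → Submodule ℂ (ℂ ⊗[ℚ] V)) (hint : DirectSum.IsInternal T)
    (h4 : ∀ p, Module.finrank ℂ (T p) = 4) (hconj : ∀ p, ∀ x ∈ T p, conj x ∈ T p)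
    (horth : ∀ p p', p ≠ p' → ∀ x ∈ T p, ∀ y ∈ T p', ψ.form.baseChange ℂ x y = 0)
    (hTE : ∀ Y : Module.End ℂ (ℂ ⊗[ℚ] V),
      (∀ a : H.endAlg, Y * (a : Module.End ℚ V).baseChange ℂ = (a : Module.End ℚ V).baseChange ℂ * Y) →
        ∀ p, Set.MapsTo Y (T p) (T p))
    (hscal : ∀ u ∈ Submodule.span ℂ ((fun a : Module.End ℚ V => a.baseChange ℂ) '' (H.endAlg : Set (Module.End ℚ V))),
      (∀ p, Set.MapsTo u (T p) (T p)) → ∀ p, ∃ c : ℂ, ∀ x ∈ T p, u x = c • x)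
    (cls : ι → ι) (hcls : ∀ p, cls (cls p) = cls p)
    (hsep : ∀ u ∈ Submodule.span ℂ ((fun a : Module.End ℚ V => a.baseChange ℂ) '' (H.endAlg : Set (Module.End ℚ V))),
      ∀ p, ∀ x ∈ T p, u x ∈ ⨆ (p') (_ : cls p' = cls p), T p')
    (hlink : ∀ p, ∃ L ∈ Submodule.span ℂ ((fun a : Module.End ℚ V => a.baseChange ℂ) '' (H.endAlg : Set (Module.End ℚ V))),
      ∃ L' : Module.End ℂ (ℂ ⊗[ℚ] V), (∀ x ∈ T p, L' x ∈ T (cls p)) ∧ ∀ x ∈ T p, L (L' x) = x)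
    (Y : Module.End ℂ (ℂ ⊗[ℚ] V)) :
    Y ∈ H.hodgeLieC ↔
      (∀ a : H.endAlg, Y * (a : Module.End ℚ V).baseChange ℂ = (a : Module.End ℚ V).baseChange ℂ * Y) ∧
      (∀ x y, ψ.form.baseChange ℂ (Y x) y + ψ.form.baseChange ℂ x (Y y) = 0) := by
  obtain ⟨Θ, hΘ⟩ := exists_hodgeTheta H
  have hΘh : Θ ∈ spanC H.hodgeLie := by
    rw [← hodgeLieC_eq_spanC]
    exact H.mem_hodgeLieC_of_forall_piece hΘ
  rw [hodgeLieC_eq_spanC]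
  exact GluedSp.mem_spanC_iff_commute_and_skew H hn heff ψ T hint h4 hconj horth hTE hscal cls hcls hsep hlink H.hodgeLie
    (fun X hX X' hX' => H.commutator_mem_hodgeLie hX hX') hΘ hΘh (fun X hX a => H.commute_of_mem_hodgeLie hX a)
    (fun X hX v w => form_apply_add_eq_zero_of_mem_hodgeLie ψ hX v w) Y

/-- **`Lie Hg(H) = 𝔰𝔭_E(V, ψ)`, rational form** (glued four-dimensional real blocks): `X ∈ Lie Hg(H)` iff `X` commutes with `E`
and is `ψ`-skew — «`Hg(X) = Sp_D(V, φ)`» for a simple abelian fourfold of Type II. [cite: MoonenZarhin1995Duke, Type II]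
[cite: MoonenZarhin1999LowDim, §2 (2.5) and §3 (3.1)] -/
theorem GluedSp.mem_hodgeLie_iff_commute_and_skew (H : HodgeStructure V n) (hn : n = 1) (heff : H.IsEffective)
    (ψ : H.Polarization) (T : ι → Submodule ℂ (ℂ ⊗[ℚ] V)) (hint : DirectSum.IsInternal T)
    (h4 : ∀ p, Module.finrank ℂ (T p) = 4) (hconj : ∀ p, ∀ x ∈ T p, conj x ∈ T p)
    (horth : ∀ p p', p ≠ p' → ∀ x ∈ T p, ∀ y ∈ T p', ψ.form.baseChange ℂ x y = 0)
    (hTE : ∀ Y : Module.End ℂ (ℂ ⊗[ℚ] V),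
      (∀ a : H.endAlg, Y * (a : Module.End ℚ V).baseChange ℂ = (a : Module.End ℚ V).baseChange ℂ * Y) →
        ∀ p, Set.MapsTo Y (T p) (T p))
    (hscal : ∀ u ∈ Submodule.span ℂ ((fun a : Module.End ℚ V => a.baseChange ℂ) '' (H.endAlg : Set (Module.End ℚ V))),
      (∀ p, Set.MapsTo u (T p) (T p)) → ∀ p, ∃ c : ℂ, ∀ x ∈ T p, u x = c • x)
    (cls : ι → ι) (hcls : ∀ p, cls (cls p) = cls p)
    (hsep : ∀ u ∈ Submodule.span ℂ ((fun a : Module.End ℚ V => a.baseChange ℂ) '' (H.endAlg : Set (Module.End ℚ V))),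
      ∀ p, ∀ x ∈ T p, u x ∈ ⨆ (p') (_ : cls p' = cls p), T p')
    (hlink : ∀ p, ∃ L ∈ Submodule.span ℂ ((fun a : Module.End ℚ V => a.baseChange ℂ) '' (H.endAlg : Set (Module.End ℚ V))),
      ∃ L' : Module.End ℂ (ℂ ⊗[ℚ] V), (∀ x ∈ T p, L' x ∈ T (cls p)) ∧ ∀ x ∈ T p, L (L' x) = x)
    (X : Module.End ℚ V) :
    X ∈ H.hodgeLie ↔
      (∀ a : H.endAlg, X * (a : Module.End ℚ V) = (a : Module.End ℚ V) * X) ∧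
      (∀ v w, ψ.form (X v) w + ψ.form v (X w) = 0) := by
  obtain ⟨Θ, hΘ⟩ := exists_hodgeTheta H
  have hΘh : Θ ∈ spanC H.hodgeLie := by
    rw [← hodgeLieC_eq_spanC]
    exact H.mem_hodgeLieC_of_forall_piece hΘ
  exact GluedSp.mem_iff_commute_and_skew H hn heff ψ T hint h4 hconj horth hTE hscal cls hcls hsep hlink H.hodgeLie
    (fun X hX X' hX' => H.commutator_mem_hodgeLie hX hX') hΘ hΘh (fun X hX a => H.commute_of_mem_hodgeLie hX a)
    (fun X hX v w => form_apply_add_eq_zero_of_mem_hodgeLie ψ hX v w) X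

end Links

section AnnLie

open Literature.RepresentationTheory.GeneralLinear Literature.NumberTheory.DiophantineGeometry

variable [Fintype ι]

/-- **Theorem L (invariance of rational tensors under `𝔰𝔭_E(V, ψ)_ℂ = ⊕_{classes} 𝔰𝔭₄`, glued four-dimensional real
blocks).** Let `H` be effective polarized of weight one, cut into four-dimensional real, mutually `ψ_ℂ`-orthogonal blocks glued
by `E_ℂ` along classes as in §5 (the `H¹` of an abelian variety of type II with `H¹` free of rank two over the quaternion algebra).
Let `q` be a RATIONAL coefficient tensor (letters: slots `Fin m` × a `ℚ`-basis `eQ` of `V`) killed — slice by slice, diagonally —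
by the matrix of the Hodge operator `Θ`. Then `q` is killed by the matrix of EVERY `ψ_ℂ`-skew operator `Y` commuting with `E_ℂ`.
Proof: the rational Lie algebra `𝔞 ⊆ 𝔰𝔭_E(V, ψ)` of `q` (`annLie`) is bracket-closed with `Θ ∈ 𝔞_ℂ` by descent
(`mem_spanC_annLie`), i.e. admissible, so `Y ∈ 𝔞_ℂ` (§5) and `𝔞_ℂ` kills `q_ℂ`. The Lie step of «`B•(Xⁿ) = D•(Xⁿ)`» for abelian
varieties of type II of quaternion rank two (Moonen–Zarhin 1995 for the simple fourfolds of Type II; V. K. Murty 1984 Thm. 3.1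
for the mechanism `Hg = L ⟹ B•(Xⁿ) = D•(Xⁿ)`). [cite: MoonenZarhin1995Duke, Type II] [cite: Murty1984, Thm. 3.1 and §3]
[cite: Deligne1982HodgeCycles, I §3 Prop. 3.4] [cite: Hazama1983, §3 (pp. 305–306)] -/
theorem GluedSp.wordDerAt_eq_zero_of_commute_of_skew {M d m : ℕ} (H : HodgeStructure V n) (hn : n = 1)
    (heff : H.IsEffective) (ψ : H.Polarization) (T : ι → Submodule ℂ (ℂ ⊗[ℚ] V)) (hint : DirectSum.IsInternal T)
    (h4 : ∀ p, Module.finrank ℂ (T p) = 4) (hconj : ∀ p, ∀ x ∈ T p, conj x ∈ T p)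
    (horth : ∀ p p', p ≠ p' → ∀ x ∈ T p, ∀ y ∈ T p', ψ.form.baseChange ℂ x y = 0)
    (hTE : ∀ Y : Module.End ℂ (ℂ ⊗[ℚ] V),
      (∀ a : H.endAlg, Y * (a : Module.End ℚ V).baseChange ℂ = (a : Module.End ℚ V).baseChange ℂ * Y) →
        ∀ p, Set.MapsTo Y (T p) (T p))
    (hscal : ∀ u ∈ Submodule.span ℂ ((fun a : Module.End ℚ V => a.baseChange ℂ) '' (H.endAlg : Set (Module.End ℚ V))),
      (∀ p, Set.MapsTo u (T p) (T p)) → ∀ p, ∃ c : ℂ, ∀ x ∈ T p, u x = c • x)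
    (cls : ι → ι) (hcls : ∀ p, cls (cls p) = cls p)
    (hsep : ∀ u ∈ Submodule.span ℂ ((fun a : Module.End ℚ V => a.baseChange ℂ) '' (H.endAlg : Set (Module.End ℚ V))),
      ∀ p, ∀ x ∈ T p, u x ∈ ⨆ (p') (_ : cls p' = cls p), T p')
    (hlink : ∀ p, ∃ L ∈ Submodule.span ℂ ((fun a : Module.End ℚ V => a.baseChange ℂ) '' (H.endAlg : Set (Module.End ℚ V))),
      ∃ L' : Module.End ℂ (ℂ ⊗[ℚ] V), (∀ x ∈ T p, L' x ∈ T (cls p)) ∧ ∀ x ∈ T p, L (L' x) = x)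
    (eQ : Module.Basis (Fin M) ℚ V) (q : (Fin d → Fin m × Fin M) → ℚ) {Θ : Module.End ℂ (ℂ ⊗[ℚ] V)}
    (hΘ : ∀ p, ∀ x ∈ H.piece p (n - p), Θ x = ((2 * p - n : ℤ) : ℂ) • x)
    (hΘq : ∀ u : Fin d → Fin m, wordDerAt ℂ (fun _ : Fin d =>
      LinearMap.toMatrix (Algebra.TensorProduct.basis ℂ eQ) (Algebra.TensorProduct.basis ℂ eQ) Θ)
      (wordSlice (fun w => algebraMap ℚ ℂ (q w)) u) = 0)
    {Y : Module.End ℂ (ℂ ⊗[ℚ] V)}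
    (hYE : ∀ a : H.endAlg, Y * (a : Module.End ℚ V).baseChange ℂ = (a : Module.End ℚ V).baseChange ℂ * Y)
    (hYskew : ∀ x y, ψ.form.baseChange ℂ (Y x) y + ψ.form.baseChange ℂ x (Y y) = 0)
    (u : Fin d → Fin m) :
    wordDerAt ℂ (fun _ : Fin d =>
      LinearMap.toMatrix (Algebra.TensorProduct.basis ℂ eQ) (Algebra.TensorProduct.basis ℂ eQ) Y)
      (wordSlice (fun w => algebraMap ℚ ℂ (q w)) u) = 0 := by
  -- the rational Lie algebra `𝔞 ⊆ 𝔰𝔭_E(V, ψ)` of `q`, with `E = End_Hdg(V)` itself as commuting family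
  set 𝔞 : Submodule ℚ (Module.End ℚ V) := annLie ψ.form eQ (fun a : H.endAlg => (a : Module.End ℚ V)) q
    with h𝔞
  have hΘC : Θ ∈ H.hodgeLieC := H.mem_hodgeLieC_of_forall_piece hΘ
  have hΘ𝔞 : Θ ∈ spanC 𝔞 :=
    mem_spanC_annLie ψ.form eQ _ q hΘq (fun a => commute_baseChange_of_mem_hodgeLieC H hΘC a)
      fun x y => by rw [formBaseChange_skew_of_mem_hodgeLieC ψ hΘC, neg_add_cancel]
  have hbr : ∀ X ∈ 𝔞, ∀ X' ∈ 𝔞, X * X' - X' * X ∈ 𝔞 := fun X hX X' hX' =>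
    commutator_mem_annLie ψ.form eQ _ q hX hX'
  have hcomm : ∀ X ∈ 𝔞, ∀ a : H.endAlg, X * (a : Module.End ℚ V) = (a : Module.End ℚ V) * X :=
    fun X hX a => ((mem_annLie_iff ψ.form eQ _ q X).1 hX).2.1 a
  have hskew : ∀ X ∈ 𝔞, ∀ v w, ψ.form (X v) w + ψ.form v (X w) = 0 :=
    fun X hX => ((mem_annLie_iff ψ.form eQ _ q X).1 hX).2.2
  have hY : Y ∈ spanC 𝔞 :=
    GluedSp.mem_spanC_of_commute_of_skew H hn heff ψ T hint h4 hconj horth hTE hscal cls hcls hsep hlink 𝔞 hbr hΘ hΘ𝔞 hcomm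
      hskew hYE hYskew
  rw [h𝔞] at hY
  exact wordDerAt_eq_zero_of_mem_spanC_annLie ψ.form eQ _ q hY u

end AnnLie

end HodgeStructure

end Literature.AlgebraicGeometry.Motives

end
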